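import Literature.MathematicalPhysics.QuantumFieldTheory.Balaban1983to89.B3Ineq210RegularRegion
import Literature.MathematicalPhysics.QuantumFieldTheory.Balaban1983to89.B3Ineq211RegularTorus
import Literature.MathematicalPhysics.QuantumFieldTheory.Balaban1983to89.B1Ineq224RegularRegion
import Literature.MathematicalPhysics.QuantumFieldTheory.Balaban1983to89.B1Prop23RegularRegionSmall
/-!
# Bałaban, *(Higgs)₂,₃ quantum fields in a finite volume III. Renormalization* [B3] — (2.11) p. 426, THE HÖLDER MEMBER OF THE
SCALE PIECES ON A REGION `Ω ⊊ T_η` (a union of big blocks) AT A REGULAR NON-CONSTANT BACKGROUND `B̃ = A`, AT INTERIOR POINTS,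
PROVED for a concrete carrier of `B3Sect2StatementsPart2.ScaledKernels` (the decl of record `ScaledKernels.Ineq211At α δ₁ C` of row
B3.Eq2.11 DISCHARGED per `α`)

statement-level skeleton of published theorems with citation tags; proofs where landed; nothing here is a claim about the Yang–Mills mass gap

T. Bałaban, Commun. Math. Phys. **88** (1983) 411–445 [cite: Balaban1983Higgs3]; inputs from part I, Commun. Math. Phys. **85**
(1982) 603–636 [cite: Balaban1982Higgs1] as landed in the tree.  PDF held: `paper:balaban1983-higgs-2-3-quantum-fields-finite-volume`
(journal page = PDF page + 410), p. 426 [PDF 16] (OCR `p0016.txt` re-read by this seat); render `run/shared/lean/pub/pub-balaban/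
b2b-balaban-ref1/pages/1983-cmp88-higgs23-III/1983-cmp88-higgs23-III-p016-x2.png`.

CITATION HEADER (lean-in-tree rule).  Cell `lit-balaban` (HOME `run/shared/lean/pub/lit-balaban/`), Phase-2 proof seat **p35** gen 16
(unit `lit-balaban-p35`; TAKING line HOME/STATUS.md 2026-08-22T20:30:55Z); SKELETON row **B3.Eq2.11** (fold owner r15; DECL OF RECORD
`B3Sect2StatementsPart2.ScaledKernels.Ineq211At`, GAPS G-B3-11: per-α constants).  The REGION TWIN of p26 g32's `B3Ineq211RegularTorus`
(p340301: (2.11) at a regular non-constant background on `Ω = T_η`) built on r14 g17's `B3Ineq210RegularRegion` (p340643: (2.10) on a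
big-block region at interior points — the region pieces `pieceR`/`sandwichR`, the interior predicate `Interior`, the carrier
`regRegionKernels`, the cut identities `G_avgQkAdj_cb_eq_zero`/`propagatorK_apply_eq_chi`, the middle sum `sum_CQG_le_R`, the
identification `mat_condCov232_levelSet` and the constant tower `towerR`).  USED BY NAME, never restated: those, p26's admissible contours
`IsAdm`/`exists_isAdm`, its coordinate expansion `norm_hol_covDeriv_sub_le_sum_coord` and its constant `cst211`; r14 g17's torus engine
pieces `sum3_le`/`exp_blockIter_le`/`blockDist_le_tdist` (`B3Ineq210RegularTorus`); THIS LINEAGE's Proposition I.2.1 inputs for big-block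
regions at a regular `A`: the (I.2.24) Hölder clause `B1Ineq224RegularRegion.norm_holder_propagatorK_region_reg_decay_sum` (p35 g12
p329713; transport `B1TorusChainTransport.hol` along nearest-neighbour chains) and the (I.2.25) value clause
`B1Ineq225RegularRegion.norm_propagatorK_region_reg_decay_sum` (p35 g12 p328271); r14 g14's (I.2.34) for regions
`B1Prop23RegularRegion.prop23_regular_region`.

## What is printed (p. 426 [PDF 16], verbatim)

*"This applies also to Hölder norms, e.g. we have
(1/|x₂−x₁|^α)|U(B̃(Γ_{x₁,x₂}))(D^η_{B̃,μ}G^η_{(j)})(Ω,B̃;x₂,x) − (D^η_{B̃,μ}G^η_{(j)})(Ω,B̃;x₁,x)| ≤ O(1)(L^jη)^{−d+1−α}e^{−δ₁(L^jη)^{−1}dist({x₁,x₂},x)},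
0 ≤ α < 1. (2.11) … These inequalities will be used in the next chapter. They all are obtained by rescaling from the η-lattice to the
L^{−j}-lattice and application of Propositions I.2.1 and I.2.3."*  I p. 610, Proposition 2.1: the inequalities hold for `x, x′ ∈ Ω` with
«dist({x,x′}, Ωᶜ) ≥ R₀»; «Γ_{x,x′} a shortest contour connecting these points».

## What this file proves (`ineq211At_regularRegion`), and how

The decl of record `ScaledKernels.Ineq211At α δ₁ C` for the concrete carrier `regRegionKernelsH _ C Ω A m² a k K₀` (= r14 g17's
`regRegionKernels` with the two (2.11) fields modelled) on a region `Ω ⊂ T_ε` that is a union of `L^kK₀`-cells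
(`B1TorusRegionHSizes.IsBigBlockUnion k K₀ Ω`), at a `δ_A`-regular (on `Ω`), non-constant `u(N)`-background `A`, at the INTERIOR points of
`Ω` (`Interior k K₀ Ω`: the lattice ball of radius `2r_S + 2L^kK₀(d+1) + 1` around the point lies in `Ω` — Proposition I.2.1's
`R₀`-clause in the tree's constants), at EVERY fixed Hölder exponent `0 ≤ α < 1`.  Route = the print's, exactly as in the torus member:
each piece `G^η_{(j)}(Ω,A) = a_j²(L^jε)^{−4}G^ε_j(Ω,A)Q_j^*C^{(j)}(Ω,A)Q_jG^ε_j(Ω,A)` (`1 ≤ j < k`; `G^η_{(0)} = G^ε_1(Ω,A)`) has its transported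
Hölder difference in the ROW variable falling on the FIRST factor `G^ε_j(Ω,A)`, bounded by Proposition I.2.1 (2.24) at a regular `A` for
big-block regions at interior points (p35 g12); the remaining factors as in r14 g17's region (2.10) ((I.2.25) value clause for `Q_jG^ε_j(Ω)`
by adjointness at an interior source point, (I.2.34) for `C^{(j)}(Ω)` on `Ω^{(j)} × Ω^{(j)}`, sources in blocks outside `Ω` do not reach
`Ω`, the three-kernel convolution from `x₁` and from `x₂`).  §0 helpers; §1 the Hölder engine on a region (`holder_G_avgQkAdj_cb_le_R`,
`holder_sandwichR_cb_le`); §2 the pieces (`holderTermR`, `holder_pieceR_zero_le`, `holder_pieceR_pos_le`); §3 the carrier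
`regRegionKernelsH`, `ineq210_iff_HR`, `holderTermR_le_holderDiff`, the transfer `ineq211At_of_boundsR`; §4 the theorem
`ineq211At_regularRegion`, its un-subtyped explicit form `ineq211At_regularRegion_explicit` (r15's request of 2026-08-22T19:56:56Z),
(2.10) ∧ (2.11) on the same region carrier (`ineq210_and_211At_regularRegionH`, with r14 g17's `ineq210_regularRegion`), and the remark
that the whole torus is an admissible region all of whose points are interior (`interior_univ`).

## Dictionary and honest scope

As `B3Ineq210RegularRegion` (`T_η ⊃ Ω`, `η = ε`; carrier `Site := {x ∈ T_ε // Interior k K₀ Ω x}` realises Prop. I.2.1's clause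
«dist({x,x′}, Ωᶜ) ≥ R₀» with the tree's margin `2r_S + 2L^kK₀(d+1) + 1` fine sites — print's `R₀` up to the constants of
`B1Ineq225RegularRegion`/`B1Ineq224RegularRegion`; ALL THREE points `x₁, x₂` (the row pair) and `x` (the source) are interior; `dist =
ε|x − x′|`; column-sum norm over the source colour of the `N × N` block kernels; covariant derivative (I.1.7) in the row variable).  The
Hölder field: `holderDiff j μ x₁ x₂ x := sup over the ADMISSIBLE CONTOURS Γ from x₁ to x₂` (p26's `IsAdm`: nearest-neighbour chains with
`|Γ| ≤ d·|x₁ − x₂|`, the reading of «a shortest contour» of p35's (I.2.24) theorems) of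
`ε^{−d}Σ_{i′}‖U(A(Γ))(D^ε_{A,μ}G^η_{(j)}(Ω,A)e_{(x,i′)})(x₂) − (D^ε_{A,μ}G^η_{(j)}(Ω,A)e_{(x,i′)})(x₁)‖` — the kernels of the REGION OPERATORS restricted to
interior points (the operators are not modified); every admissible contour's term is dominated (`holderTermR_le_holderDiff`), admissible
contours exist for every pair (p26's `exists_isAdm`); `dist2 x₁ x₂ x = ε·min(|x₁ − x|, |x₂ − x|) = dist({x₁,x₂}, x)`.  The (2.5)/(2.12)
fields stay un-modelled (`0`, as in `regRegionKernels`; nothing is claimed about them).  NOT covered: points of `Ω` closer than the margin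
to `Ωᶜ`; `m² = 0`; regions that are not unions of `L^kK₀`-cells; volumes with `K₀ ∤ M` or fewer than three cells a side at scale `k`
(`3L^kK₀ ≤ |T_ε|_μ`); charges with `e² > E₀` (the packaging of «e(L^kε) sufficiently small» in r14 g14's region form of (I.2.34), as in
the region (2.10)); the constants depend on `α` and on `K₀` and are chosen after the charge data (quantifier shape of the inputs;
GAPS G-B3-11).  Two remarks asked for by the fold owner (r15 g12, 2026-08-22T20:31:25Z): (i) NO PARITY CONDITION ON `L` survives in the
region members — the inputs ask `L ≥ 2` only (the torus members p339501/p340301 go through the `Shape` sub-family, `L` odd, of the torus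
theorems); (ii) `Ω = T_ε` IS an admissible region (`B1TorusRegionHSizes.isBigBlockUnion_univ`) all of whose points are interior
(`interior_univ`), so the region members contain the whole-torus case under their own hypotheses (`K₀ ∣ M`, `3L^kK₀ ≤ |T_ε|_μ`, `e² ≤ E₀`).
No `def … : Prop` fact, no new named fact (`holderTermR`/`regRegionKernelsH` are concrete `def`s); axioms standard.
-/

noncomputable section

open scoped BigOperators

namespace Literature.MathematicalPhysics.QuantumFieldTheory.Balaban1983to89.B3Ineq211RegularRegion

open HiggsLattice (ChargeData ScalarField covDeriv)
open HiggsCovariance (propagatorK avgQkLin avgQkAdj E)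
open HiggsAveraging (blockIter)
open HiggsFluctMeasure (coeff221)
open B1Eq221Coordinates (fieldCoord)
open B1Eq230FluctCov (mat Ix cb fluctCovA cb_repr)
open B1Ineq234Concrete (profile profile_nonneg' nCol)
open B1TorusChainTransport (IsTChain hol norm_hol_apply)
open B4GaugeCovariance (pathEnd)
open B3Sect2StatementsPart2 (ScaledKernels)
open B1TorusCubeCover (half)
open B1TorusCubeLocality26 (rS)
open B1TorusRegionHSizes (IsBigBlockUnion)
open B1TorusRegionRop (chi)
open B3Ineq210RegularTorus (norm_avgQkAdj_cb_le blockIter_eq_of_avgQkAdj_cb_ne_zero blockDist_le_tdist sum3_le exp_blockIter_le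
  norm_cb_le mesh_eq_pow_mul card_Ix eq_of_cb_ne_zero aSeq_sq_le covDeriv_smul'' covDeriv_zero'' mesh_mono)
open B3Ineq210RegularRegion (levelSet Interior regRegionKernels pieceR sandwichR pieceR_zero pieceR_of_pos pieceR_of_le
  G_avgQkAdj_cb_eq_zero abs_coord_CQG_le_R sum_CQG_le_R blockUnion_of_isBigBlockUnion isBigBlockUnion_of_le half_mono
  propagatorK_apply_eq_chi reg223R_of_small levelSet_blockUnion towerR pieceF_towerR mat_condCov232_levelSet scaleR_eq
  ineq210_regularRegion)
open B3Ineq211RegularTorus (IsAdm exists_isAdm norm_hol_sub_le norm_hol_covDeriv_sub_le_sum_coord one_le_tdist_of_ne'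
  cst211 cst211_pos le_cst211_zero le_cst211_pos)

variable {P : HiggsLattice.Params} {N : ℕ}

/-! ## §0 Helpers: decay factors and the covariant derivative at a bond whose end-points agree -/

section Helpers

/-- Rate weakening in a decay factor. [folklore] -/
private theorem exp_rate_mono {ρ ρ' s : ℝ} (h : ρ' ≤ ρ) (hs : 0 ≤ s) : Real.exp (-(ρ * s)) ≤ Real.exp (-(ρ' * s)) :=
  Real.exp_le_exp.mpr (by nlinarith)

/-- Monotonicity of a decay factor in the distance. [folklore] -/
private theorem exp_dist_mono {ρ s s' : ℝ} (hρ : 0 ≤ ρ) (h : s' ≤ s) : Real.exp (-(ρ * s)) ≤ Real.exp (-(ρ * s')) :=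
  Real.exp_le_exp.mpr (by nlinarith)

/-- `e^{−ρa} + e^{−ρb} ≤ 2e^{−ρ·min(a,b)}` for `ρ ≥ 0`. [folklore] -/
private theorem add_exp_le_two_exp_min {ρ : ℝ} (hρ : 0 ≤ ρ) (a b : ℝ) :
    Real.exp (-(ρ * a)) + Real.exp (-(ρ * b)) ≤ 2 * Real.exp (-(ρ * min a b)) := by
  have ha := exp_dist_mono hρ (min_le_left a b)
  have hb := exp_dist_mono hρ (min_le_right a b)
  linarith

/-- The decay factor at the block distance: `e^{−δD/L^l} ≤ e^{δ}e^{−δt}` for `D = max(0, L^l·t − (L^l − 1))`. [folklore] -/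
private theorem exp_blockDist_le {l : ℕ} (t : ℝ) {δ : ℝ} (hδ : 0 ≤ δ) :
    Real.exp (-(δ * (max 0 ((P.L : ℝ) ^ l * t - ((P.L : ℝ) ^ l - 1)) / (P.L : ℝ) ^ l)))
      ≤ Real.exp δ * Real.exp (-(δ * t)) := by
  rw [← Real.exp_add]
  apply Real.exp_le_exp.mpr
  have hT : (0 : ℝ) < (P.L : ℝ) ^ l := pow_pos (by exact_mod_cast P.hL) l
  have h2 : t - 1 ≤ max 0 ((P.L : ℝ) ^ l * t - ((P.L : ℝ) ^ l - 1)) / (P.L : ℝ) ^ l := by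
    rw [le_div_iff₀ hT]
    have h1 : (P.L : ℝ) ^ l * t - ((P.L : ℝ) ^ l - 1) ≤ max 0 ((P.L : ℝ) ^ l * t - ((P.L : ℝ) ^ l - 1)) :=
      le_max_right _ _
    nlinarith
  nlinarith [mul_le_mul_of_nonneg_left h2 hδ]

/-- weakening in the exponent: `e^{−u} ≤ e^{−v}` when `v ≤ u`. [folklore] -/
private theorem exp_le_exp_of_le {u v : ℝ} (h : v ≤ u) : Real.exp (-u) ≤ Real.exp (-v) :=
  Real.exp_le_exp.mpr (neg_le_neg h)

/-- p35's rate `D/(4K₀L^l)` dominates a common rate `δ ≤ 1/(4K₀)`. [folklore] -/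
private theorem exp_p35_le {K₀ l : ℕ} (hK₀ : 0 < K₀) {δ D : ℝ} (hδ : δ ≤ 1 / (4 * K₀)) (hD : 0 ≤ D)
    (hLl : (0 : ℝ) < (P.L : ℝ) ^ l) :
    Real.exp (-(D / (4 * K₀ * (P.L : ℝ) ^ l))) ≤ Real.exp (-(δ * (D / (P.L : ℝ) ^ l))) := by
  apply exp_le_exp_of_le
  have hK : (0 : ℝ) < 4 * K₀ := by positivity
  have h1 : D / (4 * K₀ * (P.L : ℝ) ^ l) = 1 / (4 * K₀) * (D / (P.L : ℝ) ^ l) := by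
    field_simp
  rw [h1]
  exact mul_le_mul_of_nonneg_right hδ (by positivity)

/-- Two fields agreeing at the end-points of a bond have the same covariant derivative there. [cite: Balaban1982Higgs1, (1.7) p.605] -/
theorem covDeriv_congr_bond (C : ChargeData N) (A : HiggsLattice.VecField P 0) {w w' : ScalarField P 0 N}
    {b : HiggsLattice.PBond P 0} (hs : w b.src = w' b.src) (ht : w b.tgt = w' b.tgt) :
    covDeriv C A w b = covDeriv C A w' b := by
  rw [B1Cor23RegularRegion.covDeriv_eq, B1Cor23RegularRegion.covDeriv_eq, hs, ht]

end Helpers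

/-! ## §1 The Hölder engine on a region: the transported difference of one sandwich `G^ε_l(Ω)Q_l^*C^{(l)}(Ω)Q_lG^ε_l(Ω)` at interior points

At one level `1 ≤ l ≤ K` the inputs are taken as hypotheses in the shape the tree's theorems print them, at «good» (interior) points
only: `hH` = the (I.2.24) Hölder clause for `G^ε_l(Ω, A)` at a fixed exponent `α` with both row points good (p35 g12's region theorem,
weight `(|x₁ − x₂|/L^l)^{−α}` on the left, decay from the pair `{x₁, x₂}`), `hG` = the (I.2.25) value clause at a good point (the third
kernel, by adjointness), `hC` = the (I.2.34) kernel bound of `C^{(l)}(Ω, A)` on `Ω^{(l)} × Ω^{(l)}`; sources in blocks outside `Ω` do not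
reach `Ω` (r14 g17's `G_avgQkAdj_cb_eq_zero`). -/

section EngineR

variable (C : ChargeData N) (Ω : Finset (HiggsLattice.Site P 0)) (A : HiggsLattice.VecField P 0) (msq a : ℝ) {l : ℕ} {α : ℝ}

/-- **First kernel on a region, Hölder-transported** — for good `x₁ ≠ x₂` and an admissible contour `Γ` from `x₁` to `x₂`:
`(|x₁−x₂|/L^l)^{−α}‖U(A(Γ))(D^ε_AG^ε_l(Ω)Q_l^*e_s)(⟨x₂,μ⟩) − (D^ε_AG^ε_l(Ω)Q_l^*e_s)(⟨x₁,μ⟩)‖ ≤ c_H·e^{δ}·(e^{−δ|x₁,ₗ − y_s|} + e^{−δ|x₂,ₗ − y_s|})·√N`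
from the (I.2.24) Hölder clause at level `l` on the region (source `Q_l^*e_s`: sup `≤ √N`, support `B^l(y_s)`).
[cite: Balaban1982Higgs1, Prop. 2.1 (2.24) p.610] [cite: Balaban1983Higgs3, (2.11) p.426] -/
theorem holder_G_avgQkAdj_cb_le_R (hl : l ≤ P.K) {good : HiggsLattice.Site P 0 → Prop} {cH δ : ℝ} (hcH : 0 ≤ cH) (hδ : 0 ≤ δ)
    (hH : ∀ (g : ScalarField P 0 N) (M D : ℝ), (∀ x, ‖g x‖ ≤ M) → 0 ≤ D →
      ∀ (μ : Fin P.d) (x x' : HiggsLattice.Site P 0), x' ≠ x → good x → good x' →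
        ∀ Γ : List (HiggsLattice.Site P 0), IsTChain x Γ →
        pathEnd x Γ = x' → (Γ.length : ℝ) ≤ (P.d : ℝ) * HiggsLattice.Site.tdist x x' →
        (∀ z, g z ≠ 0 → D ≤ (HiggsLattice.Site.tdist x z : ℝ)) → (∀ z, g z ≠ 0 → D ≤ (HiggsLattice.Site.tdist x' z : ℝ)) →
          (((HiggsLattice.Site.tdist x x' : ℝ) / (P.L : ℝ) ^ l)⁻¹) ^ α *
              ‖hol C A x Γ (covDeriv C A (propagatorK C Ω A msq a l g) ⟨x', μ⟩)
                - covDeriv C A (propagatorK C Ω A msq a l g) ⟨x, μ⟩‖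
            ≤ cH * Real.exp (-(δ * (D / (P.L : ℝ) ^ l))) * M)
    (s : HiggsLattice.Site P l × Ix N) (μ : Fin P.d) {x₁ x₂ : HiggsLattice.Site P 0} (hne : x₂ ≠ x₁)
    (hx₁ : good x₁) (hx₂ : good x₂) {Γ : List (HiggsLattice.Site P 0)} (hΓ : IsAdm x₁ x₂ Γ) :
    (((HiggsLattice.Site.tdist x₁ x₂ : ℝ) / (P.L : ℝ) ^ l)⁻¹) ^ α *
        ‖hol C A x₁ Γ (covDeriv C A (propagatorK C Ω A msq a l (avgQkAdj C A l (cb P N l s))) ⟨x₂, μ⟩)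
          - covDeriv C A (propagatorK C Ω A msq a l (avgQkAdj C A l (cb P N l s))) ⟨x₁, μ⟩‖
      ≤ cH * Real.exp δ * (Real.exp (-(δ * (HiggsLattice.Site.tdist (blockIter l x₁) s.1 : ℝ))) +
          Real.exp (-(δ * (HiggsLattice.Site.tdist (blockIter l x₂) s.1 : ℝ)))) * Real.sqrt N := by
  set D₁ : ℝ := max 0 ((P.L : ℝ) ^ l * (HiggsLattice.Site.tdist (blockIter l x₁) s.1 : ℝ) - ((P.L : ℝ) ^ l - 1)) with hD₁
  set D₂ : ℝ := max 0 ((P.L : ℝ) ^ l * (HiggsLattice.Site.tdist (blockIter l x₂) s.1 : ℝ) - ((P.L : ℝ) ^ l - 1)) with hD₂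
  have h := hH (avgQkAdj C A l (cb P N l s)) (Real.sqrt N) (min D₁ D₂) (norm_avgQkAdj_cb_le C A s)
    (le_min (le_max_left _ _) (le_max_left _ _)) μ x₁ x₂ hne hx₁ hx₂ Γ hΓ.1 hΓ.2.1 hΓ.2.2
    (fun z hz => (min_le_left _ _).trans (blockDist_le_tdist hl x₁ s.1 (blockIter_eq_of_avgQkAdj_cb_ne_zero C A s hz)))
    (fun z hz => (min_le_right _ _).trans (blockDist_le_tdist hl x₂ s.1 (blockIter_eq_of_avgQkAdj_cb_ne_zero C A s hz)))
  refine h.trans ?_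
  have hs : 0 ≤ Real.sqrt (N : ℝ) := Real.sqrt_nonneg _
  have he : Real.exp (-(δ * (min D₁ D₂ / (P.L : ℝ) ^ l)))
      ≤ Real.exp δ * (Real.exp (-(δ * (HiggsLattice.Site.tdist (blockIter l x₁) s.1 : ℝ))) +
          Real.exp (-(δ * (HiggsLattice.Site.tdist (blockIter l x₂) s.1 : ℝ)))) := by
    have h1 := exp_blockDist_le (P := P) (l := l) (HiggsLattice.Site.tdist (blockIter l x₁) s.1 : ℝ) hδ
    have h2 := exp_blockDist_le (P := P) (l := l) (HiggsLattice.Site.tdist (blockIter l x₂) s.1 : ℝ) hδ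
    rw [← hD₁] at h1
    rw [← hD₂] at h2
    have e1 : 0 ≤ Real.exp δ * Real.exp (-(δ * (HiggsLattice.Site.tdist (blockIter l x₁) s.1 : ℝ))) := by positivity
    have e2 : 0 ≤ Real.exp δ * Real.exp (-(δ * (HiggsLattice.Site.tdist (blockIter l x₂) s.1 : ℝ))) := by positivity
    rcases min_choice D₁ D₂ with hm | hm <;> rw [hm] <;> linarith
  calc cH * Real.exp (-(δ * (min D₁ D₂ / (P.L : ℝ) ^ l))) * Real.sqrt N
      ≤ cH * (Real.exp δ * (Real.exp (-(δ * (HiggsLattice.Site.tdist (blockIter l x₁) s.1 : ℝ))) +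
          Real.exp (-(δ * (HiggsLattice.Site.tdist (blockIter l x₂) s.1 : ℝ))))) * Real.sqrt N :=
        mul_le_mul_of_nonneg_right (mul_le_mul_of_nonneg_left he hcH) hs
    _ = _ := by ring

/-- **A source in a block OUTSIDE `Ω` has NO transported Hölder difference at good points**: for `y_s ∉ Ω^{(l)}` and good `x`,
`(D^ε_AG^ε_l(Ω)Q_l^*e_s)(⟨x,μ⟩) = 0` (both end-points of the bond lie in `Ω`, where `G^ε_l(Ω)Q_l^*e_s` vanishes).
[cite: Balaban1982Higgs1, (2.20) p.610] -/
theorem covDeriv_G_avgQkAdj_cb_eq_zero (hmsq : 0 < msq) (hak : 0 ≤ B1.aSeq a P.L l)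
    (hΩ : ∀ x x' : HiggsLattice.Site P 0, blockIter l x = blockIter l x' → (x ∈ Ω ↔ x' ∈ Ω))
    {good : HiggsLattice.Site P 0 → Prop} (hgood : ∀ x, good x → x ∈ Ω)
    (hgood' : ∀ (x : HiggsLattice.Site P 0) (μ : Fin P.d), good x → x.shift μ ∈ Ω)
    (s : HiggsLattice.Site P l × Ix N) (hs : s.1 ∉ levelSet l Ω) (μ : Fin P.d) {x : HiggsLattice.Site P 0} (hx : good x) :
    covDeriv C A (propagatorK C Ω A msq a l (avgQkAdj C A l (cb P N l s))) ⟨x, μ⟩ = 0 := by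
  have hsrc : propagatorK C Ω A msq a l (avgQkAdj C A l (cb P N l s)) (⟨x, μ⟩ : HiggsLattice.PBond P 0).src = 0 :=
    G_avgQkAdj_cb_eq_zero C Ω A msq a hmsq hak hΩ s hs (hgood x hx)
  have htgt : propagatorK C Ω A msq a l (avgQkAdj C A l (cb P N l s)) (⟨x, μ⟩ : HiggsLattice.PBond P 0).tgt = 0 :=
    G_avgQkAdj_cb_eq_zero C Ω A msq a hmsq hak hΩ s hs (hgood' x μ hx)
  rw [B1Cor23RegularRegion.covDeriv_eq, hsrc, htgt]
  simp

/-- **THE SANDWICH ON A REGION, HÖLDER-TRANSPORTED** — from the three inputs at level `l ≤ K` with a common rate `δ > 0`, for good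
`x₁ ≠ x₂`, a good source point `x_q` and an admissible contour `Γ` from `x₁` to `x₂`:
`(|x₁−x₂|/L^l)^{−α}‖U(A(Γ))(D^ε_A G^ε_l(Ω)Q_l^*C^{(l)}(Ω)Q_lG^ε_l(Ω) e_q)(⟨x₂,μ⟩) − (D^ε_A G^ε_l(Ω)Q_l^*C^{(l)}(Ω)Q_lG^ε_l(Ω) e_q)(⟨x₁,μ⟩)‖
 ≤ (c_He^{δ}√N)(c_Ge^{δ}√N)·c_C·L^{−ld}·(2K(δ/2)²e^{δ/2})·e^{−(δ/2)min(|x₁ − x_q|, |x₂ − x_q|)/L^l}` — p26's torus engine with r14 g17's region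
kernels (block points outside `Ω^{(l)}` contribute nothing). [cite: Balaban1982Higgs1, (2.43) p.612, Prop. 2.1 (2.24)–(2.25) p.610, Prop. 2.3 (2.34) p.611]
[cite: Balaban1983Higgs3, (2.11) p.426] -/
theorem holder_sandwichR_cb_le (hl : l ≤ P.K) (hmsq : 0 < msq) (hak : 0 ≤ B1.aSeq a P.L l)
    (hΩ : ∀ x x' : HiggsLattice.Site P 0, blockIter l x = blockIter l x' → (x ∈ Ω ↔ x' ∈ Ω))
    {good : HiggsLattice.Site P 0 → Prop} (hgood : ∀ x, good x → x ∈ Ω)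
    (hgood' : ∀ (x : HiggsLattice.Site P 0) (μ : Fin P.d), good x → x.shift μ ∈ Ω)
    {cG cH cC δ : ℝ} (hcG : 0 ≤ cG) (hcH : 0 ≤ cH) (hcC : 0 ≤ cC) (hδ : 0 < δ)
    (hG : ∀ (g : ScalarField P 0 N) (M D : ℝ), (∀ x, ‖g x‖ ≤ M) → 0 ≤ D →
      ∀ x, good x → (∀ z, g z ≠ 0 → D ≤ (HiggsLattice.Site.tdist x z : ℝ)) →
        ‖propagatorK C Ω A msq a l g x‖ ≤ cG * Real.exp (-(δ * (D / (P.L : ℝ) ^ l))) * M)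
    (hH : ∀ (g : ScalarField P 0 N) (M D : ℝ), (∀ x, ‖g x‖ ≤ M) → 0 ≤ D →
      ∀ (μ : Fin P.d) (x x' : HiggsLattice.Site P 0), x' ≠ x → good x → good x' →
        ∀ Γ : List (HiggsLattice.Site P 0), IsTChain x Γ →
        pathEnd x Γ = x' → (Γ.length : ℝ) ≤ (P.d : ℝ) * HiggsLattice.Site.tdist x x' →
        (∀ z, g z ≠ 0 → D ≤ (HiggsLattice.Site.tdist x z : ℝ)) → (∀ z, g z ≠ 0 → D ≤ (HiggsLattice.Site.tdist x' z : ℝ)) →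
          (((HiggsLattice.Site.tdist x x' : ℝ) / (P.L : ℝ) ^ l)⁻¹) ^ α *
              ‖hol C A x Γ (covDeriv C A (propagatorK C Ω A msq a l g) ⟨x', μ⟩)
                - covDeriv C A (propagatorK C Ω A msq a l g) ⟨x, μ⟩‖
            ≤ cH * Real.exp (-(δ * (D / (P.L : ℝ) ^ l))) * M)
    (hC : ∀ s t : HiggsLattice.Site P l × Ix N, s.1 ∈ levelSet l Ω → t.1 ∈ levelSet l Ω →
      |mat (fluctCovA C Ω A msq a l) s t| ≤ cC * Real.exp (-(δ * (HiggsLattice.Site.tdist s.1 t.1 : ℝ))))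
    {q : HiggsLattice.Site P 0 × Ix N} (hq : good q.1) (μ : Fin P.d) {x₁ x₂ : HiggsLattice.Site P 0} (hne : x₂ ≠ x₁)
    (hx₁ : good x₁) (hx₂ : good x₂) {Γ : List (HiggsLattice.Site P 0)} (hΓ : IsAdm x₁ x₂ Γ) :
    (((HiggsLattice.Site.tdist x₁ x₂ : ℝ) / (P.L : ℝ) ^ l)⁻¹) ^ α *
        ‖hol C A x₁ Γ (covDeriv C A (sandwichR C Ω A msq a l (cb P N 0 q)) ⟨x₂, μ⟩)
          - covDeriv C A (sandwichR C Ω A msq a l (cb P N 0 q)) ⟨x₁, μ⟩‖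
      ≤ (cH * Real.exp δ * Real.sqrt N) * (cG * Real.exp δ * Real.sqrt N) * cC * (((P.L : ℝ) ^ l) ^ P.d)⁻¹ *
          (2 * profile P N (δ / 2) ^ 2 * Real.exp (δ / 2)) *
          Real.exp (-(δ / 2 * (min (HiggsLattice.Site.tdist x₁ q.1 : ℝ) (HiggsLattice.Site.tdist x₂ q.1 : ℝ) / (P.L : ℝ) ^ l))) := by
  set W : ℝ := (((HiggsLattice.Site.tdist x₁ x₂ : ℝ) / (P.L : ℝ) ^ l)⁻¹) ^ α with hW
  have hW0 : 0 ≤ W := Real.rpow_nonneg (inv_nonneg.mpr (by positivity)) _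
  have h0 : sandwichR C Ω A msq a l (cb P N 0 q) = (propagatorK C Ω A msq a l ∘ₗ avgQkAdj C A l)
      (fluctCovA C Ω A msq a l (avgQkLin C A l (propagatorK C Ω A msq a l (cb P N 0 q)))) := by
    simp only [sandwichR, LinearMap.comp_apply]
  rw [h0]
  have hK : 0 ≤ profile P N (δ / 2) := profile_nonneg' _ (by linarith)
  -- coordinate expansion, the weight distributed over the sum
  refine (mul_le_mul_of_nonneg_left (norm_hol_covDeriv_sub_le_sum_coord C A _ _ x₁ x₂ Γ μ) hW0).trans ?_
  rw [Finset.mul_sum]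
  calc ∑ s : HiggsLattice.Site P l × Ix N, W * (|fieldCoord (E N) (HiggsLattice.Site P l)
            (fluctCovA C Ω A msq a l (avgQkLin C A l (propagatorK C Ω A msq a l (cb P N 0 q)))) s| *
          ‖hol C A x₁ Γ (covDeriv C A ((propagatorK C Ω A msq a l ∘ₗ avgQkAdj C A l) (cb P N l s)) ⟨x₂, μ⟩)
            - covDeriv C A ((propagatorK C Ω A msq a l ∘ₗ avgQkAdj C A l) (cb P N l s)) ⟨x₁, μ⟩‖)
      ≤ ∑ s : HiggsLattice.Site P l × Ix N,
          (∑ t : HiggsLattice.Site P l × Ix N, cC * Real.exp (-(δ * (HiggsLattice.Site.tdist s.1 t.1 : ℝ))) *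
            ((((P.L : ℝ) ^ l) ^ P.d)⁻¹ *
              (cG * Real.exp δ * Real.exp (-(δ * (HiggsLattice.Site.tdist (blockIter l q.1) t.1 : ℝ))) * Real.sqrt N))) *
          (cH * Real.exp δ * (Real.exp (-(δ * (HiggsLattice.Site.tdist (blockIter l x₁) s.1 : ℝ))) +
            Real.exp (-(δ * (HiggsLattice.Site.tdist (blockIter l x₂) s.1 : ℝ)))) * Real.sqrt N) := by
        refine Finset.sum_le_sum fun s _ => ?_
        by_cases hs : s.1 ∈ levelSet l Ω
        · have h1 : |fieldCoord (E N) (HiggsLattice.Site P l)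
                (fluctCovA C Ω A msq a l (avgQkLin C A l (propagatorK C Ω A msq a l (cb P N 0 q)))) s|
              ≤ ∑ t : HiggsLattice.Site P l × Ix N, cC * Real.exp (-(δ * (HiggsLattice.Site.tdist s.1 t.1 : ℝ))) *
                ((((P.L : ℝ) ^ l) ^ P.d)⁻¹ *
                  (cG * Real.exp δ * Real.exp (-(δ * (HiggsLattice.Site.tdist (blockIter l q.1) t.1 : ℝ))) * Real.sqrt N)) :=
            (abs_coord_CQG_le_R C Ω A msq a s q).trans
              (sum_CQG_le_R C Ω A msq a hl hmsq hak hΩ hgood hcG hcC hδ.le hG hC hs hq)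
          have h2 : W * ‖hol C A x₁ Γ (covDeriv C A ((propagatorK C Ω A msq a l ∘ₗ avgQkAdj C A l) (cb P N l s)) ⟨x₂, μ⟩)
                - covDeriv C A ((propagatorK C Ω A msq a l ∘ₗ avgQkAdj C A l) (cb P N l s)) ⟨x₁, μ⟩‖
              ≤ cH * Real.exp δ * (Real.exp (-(δ * (HiggsLattice.Site.tdist (blockIter l x₁) s.1 : ℝ))) +
                  Real.exp (-(δ * (HiggsLattice.Site.tdist (blockIter l x₂) s.1 : ℝ)))) * Real.sqrt N := by
            rw [LinearMap.comp_apply]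
            exact holder_G_avgQkAdj_cb_le_R C Ω A msq a hl hcH hδ.le hH s μ hne hx₁ hx₂ hΓ
          calc W * (|fieldCoord (E N) (HiggsLattice.Site P l)
                  (fluctCovA C Ω A msq a l (avgQkLin C A l (propagatorK C Ω A msq a l (cb P N 0 q)))) s| *
                ‖hol C A x₁ Γ (covDeriv C A ((propagatorK C Ω A msq a l ∘ₗ avgQkAdj C A l) (cb P N l s)) ⟨x₂, μ⟩)
                  - covDeriv C A ((propagatorK C Ω A msq a l ∘ₗ avgQkAdj C A l) (cb P N l s)) ⟨x₁, μ⟩‖)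
              = |fieldCoord (E N) (HiggsLattice.Site P l)
                  (fluctCovA C Ω A msq a l (avgQkLin C A l (propagatorK C Ω A msq a l (cb P N 0 q)))) s| *
                (W * ‖hol C A x₁ Γ (covDeriv C A ((propagatorK C Ω A msq a l ∘ₗ avgQkAdj C A l) (cb P N l s)) ⟨x₂, μ⟩)
                  - covDeriv C A ((propagatorK C Ω A msq a l ∘ₗ avgQkAdj C A l) (cb P N l s)) ⟨x₁, μ⟩‖) := by ring
            _ ≤ _ := mul_le_mul h1 h2 (mul_nonneg hW0 (norm_nonneg _)) (Finset.sum_nonneg fun t _ => by positivity)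
        · -- the source block lies outside `Ω`: both covariant derivatives vanish
          have hz₁ : covDeriv C A ((propagatorK C Ω A msq a l ∘ₗ avgQkAdj C A l) (cb P N l s)) ⟨x₁, μ⟩ = 0 := by
            rw [LinearMap.comp_apply]
            exact covDeriv_G_avgQkAdj_cb_eq_zero C Ω A msq a hmsq hak hΩ hgood hgood' s hs μ hx₁
          have hz₂ : covDeriv C A ((propagatorK C Ω A msq a l ∘ₗ avgQkAdj C A l) (cb P N l s)) ⟨x₂, μ⟩ = 0 := by
            rw [LinearMap.comp_apply]
            exact covDeriv_G_avgQkAdj_cb_eq_zero C Ω A msq a hmsq hak hΩ hgood hgood' s hs μ hx₂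
          rw [hz₁, hz₂, map_zero, sub_zero, norm_zero, mul_zero, mul_zero]
          exact mul_nonneg (Finset.sum_nonneg fun t _ => by positivity) (by positivity)
    _ = (cH * Real.exp δ * Real.sqrt N) * (cG * Real.exp δ * Real.sqrt N) * cC * (((P.L : ℝ) ^ l) ^ P.d)⁻¹ *
          ((∑ s : HiggsLattice.Site P l × Ix N, ∑ t : HiggsLattice.Site P l × Ix N,
            Real.exp (-(δ * (HiggsLattice.Site.tdist (blockIter l x₁) s.1 : ℝ))) *
              Real.exp (-(δ * (HiggsLattice.Site.tdist s.1 t.1 : ℝ))) *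
              Real.exp (-(δ * (HiggsLattice.Site.tdist (blockIter l q.1) t.1 : ℝ)))) +
          (∑ s : HiggsLattice.Site P l × Ix N, ∑ t : HiggsLattice.Site P l × Ix N,
            Real.exp (-(δ * (HiggsLattice.Site.tdist (blockIter l x₂) s.1 : ℝ))) *
              Real.exp (-(δ * (HiggsLattice.Site.tdist s.1 t.1 : ℝ))) *
              Real.exp (-(δ * (HiggsLattice.Site.tdist (blockIter l q.1) t.1 : ℝ))))) := by
        rw [← Finset.sum_add_distrib, Finset.mul_sum]
        refine Finset.sum_congr rfl fun s _ => ?_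
        rw [← Finset.sum_add_distrib, Finset.sum_mul, Finset.mul_sum]
        refine Finset.sum_congr rfl fun t _ => ?_
        ring
    _ ≤ (cH * Real.exp δ * Real.sqrt N) * (cG * Real.exp δ * Real.sqrt N) * cC * (((P.L : ℝ) ^ l) ^ P.d)⁻¹ *
          (profile P N (δ / 2) ^ 2 * Real.exp (-(δ / 2 * (HiggsLattice.Site.tdist (blockIter l x₁) (blockIter l q.1) : ℝ))) +
            profile P N (δ / 2) ^ 2 * Real.exp (-(δ / 2 * (HiggsLattice.Site.tdist (blockIter l x₂) (blockIter l q.1) : ℝ)))) :=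
        mul_le_mul_of_nonneg_left (add_le_add (sum3_le hδ (blockIter l x₁) (blockIter l q.1) q.2)
          (sum3_le hδ (blockIter l x₂) (blockIter l q.1) q.2)) (by positivity)
    _ ≤ (cH * Real.exp δ * Real.sqrt N) * (cG * Real.exp δ * Real.sqrt N) * cC * (((P.L : ℝ) ^ l) ^ P.d)⁻¹ *
          (profile P N (δ / 2) ^ 2 * (Real.exp (δ / 2) *
            Real.exp (-(δ / 2 * ((HiggsLattice.Site.tdist x₁ q.1 : ℝ) / (P.L : ℝ) ^ l)))) +
          profile P N (δ / 2) ^ 2 * (Real.exp (δ / 2) *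
            Real.exp (-(δ / 2 * ((HiggsLattice.Site.tdist x₂ q.1 : ℝ) / (P.L : ℝ) ^ l))))) :=
        mul_le_mul_of_nonneg_left (add_le_add
          (mul_le_mul_of_nonneg_left (exp_blockIter_le hl hδ.le x₁ q.1) (pow_nonneg hK 2))
          (mul_le_mul_of_nonneg_left (exp_blockIter_le hl hδ.le x₂ q.1) (pow_nonneg hK 2))) (by positivity)
    _ = (cH * Real.exp δ * Real.sqrt N) * (cG * Real.exp δ * Real.sqrt N) * cC * (((P.L : ℝ) ^ l) ^ P.d)⁻¹ *
          (profile P N (δ / 2) ^ 2 * Real.exp (δ / 2)) *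
          (Real.exp (-(δ / 2 * ((HiggsLattice.Site.tdist x₁ q.1 : ℝ) / (P.L : ℝ) ^ l))) +
            Real.exp (-(δ / 2 * ((HiggsLattice.Site.tdist x₂ q.1 : ℝ) / (P.L : ℝ) ^ l)))) := by ring
    _ ≤ (cH * Real.exp δ * Real.sqrt N) * (cG * Real.exp δ * Real.sqrt N) * cC * (((P.L : ℝ) ^ l) ^ P.d)⁻¹ *
          (profile P N (δ / 2) ^ 2 * Real.exp (δ / 2)) *
          (2 * Real.exp (-(δ / 2 * (min (HiggsLattice.Site.tdist x₁ q.1 : ℝ) (HiggsLattice.Site.tdist x₂ q.1 : ℝ) /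
            (P.L : ℝ) ^ l)))) := by
        refine mul_le_mul_of_nonneg_left ?_ (by positivity)
        have hT : (0 : ℝ) < (P.L : ℝ) ^ l := pow_pos (by exact_mod_cast P.hL) l
        rw [← min_div_div_right hT.le]
        exact add_exp_le_two_exp_min (by linarith) _ _
    _ = _ := by ring

end EngineR

/-! ## §2 The pieces on a region: `(|x₁−x₂|/L^j)^{−α}·ε^{−d}Σ_{i′}‖U(A(Γ))(D^ε_{A,μ}G^η_{(j)}(Ω,A)e_{(x,i′)})(x₂) − (D^ε_{A,μ}G^η_{(j)}(Ω,A)e_{(x,i′)})(x₁)‖`,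
piece by piece at interior points -/

section PieceBoundsR

variable (C : ChargeData N) (Ω : Finset (HiggsLattice.Site P 0)) (A : HiggsLattice.VecField P 0) (msq : ℝ) {a : ℝ} {k j : ℕ}
  {α : ℝ} {good : HiggsLattice.Site P 0 → Prop}

/-- The transported Hölder term of the region piece `j` along the contour `Γ` (the summand of `holderDiff` before the supremum):
`ε^{−d}Σ_{i′}‖U(A(Γ))(D^ε_{A,μ}G^η_{(j)}(Ω,A)e_{(x,i′)})(⟨x₂,μ⟩) − (D^ε_{A,μ}G^η_{(j)}(Ω,A)e_{(x,i′)})(⟨x₁,μ⟩)‖`. [cite: Balaban1983Higgs3, (2.11) p.426] -/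
def holderTermR (a : ℝ) (k j : ℕ) (μ : Fin P.d) (x₁ x₂ x : HiggsLattice.Site P 0) (Γ : List (HiggsLattice.Site P 0)) : ℝ :=
  (P.mesh 0 ^ P.d)⁻¹ * ∑ i' : Ix N,
    ‖hol C A x₁ Γ (covDeriv C A (pieceR C Ω A msq a k j (cb P N 0 (x, i'))) ⟨x₂, μ⟩)
      - covDeriv C A (pieceR C Ω A msq a k j (cb P N 0 (x, i'))) ⟨x₁, μ⟩‖

/-- `holderTermR ≥ 0`. [cite: Balaban1983Higgs3, (2.11) p.426] -/
theorem holderTermR_nonneg (μ : Fin P.d) (x₁ x₂ x : HiggsLattice.Site P 0) (Γ : List (HiggsLattice.Site P 0)) :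
    0 ≤ holderTermR C Ω A msq a k j μ x₁ x₂ x Γ :=
  mul_nonneg (inv_nonneg.mpr (pow_nonneg (P.mesh_pos 0).le _)) (Finset.sum_nonneg fun _ _ => norm_nonneg _)

/-- A contour-independent bound (the transports are isometries): `holderTermR ≤ ε^{−d}Σ_{i′}(‖(D G e)(x₂)‖ + ‖(D G e)(x₁)‖)`.
[cite: Balaban1982Higgs1, (1.7) p.605] -/
theorem holderTermR_le_unif (μ : Fin P.d) (x₁ x₂ x : HiggsLattice.Site P 0) (Γ : List (HiggsLattice.Site P 0)) :
    holderTermR C Ω A msq a k j μ x₁ x₂ x Γ ≤ (P.mesh 0 ^ P.d)⁻¹ * ∑ i' : Ix N,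
      (‖covDeriv C A (pieceR C Ω A msq a k j (cb P N 0 (x, i'))) ⟨x₂, μ⟩‖
        + ‖covDeriv C A (pieceR C Ω A msq a k j (cb P N 0 (x, i'))) ⟨x₁, μ⟩‖) := by
  unfold holderTermR
  exact mul_le_mul_of_nonneg_left (Finset.sum_le_sum fun i' _ => norm_hol_sub_le C A x₁ Γ _ _)
    (inv_nonneg.mpr (pow_nonneg (P.mesh_pos 0).le _))

/-- scaling bookkeeping: `ε^{−d}·L^{−jd} = (L^jε)^{−d}`. [cite: Balaban1982Higgs1, (1.19) p.607] -/
private theorem inv_mesh_zero_pow_mul (j : ℕ) :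
    (P.mesh 0 ^ P.d)⁻¹ * (((P.L : ℝ) ^ j) ^ P.d)⁻¹ = (P.mesh j ^ P.d)⁻¹ := by
  rw [mesh_eq_pow_mul P j, mul_pow, mul_inv, mul_comm]

/-- scaling bookkeeping: `(L^jε)^{−n}(L^jε)^{n+m} = (L^jε)^m`. [cite: Balaban1982Higgs1, (1.19) p.607] -/
private theorem mesh_pow_cancel (j n m : ℕ) : (P.mesh j ^ n)⁻¹ * P.mesh j ^ (n + m) = P.mesh j ^ m := by
  rw [pow_add, inv_mul_cancel_left₀ (pow_ne_zero _ (P.mesh_pos j).ne')]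

/-- **Piece `j = 0` on a region**: `(|x₁−x₂|/L^0)^{−α}·ε^{−d}Σ_{i′}‖U(A(Γ))(D^ε_AG^ε_1(Ω)e_{(x,i′)})(⟨x₂,μ⟩) − (D^ε_AG^ε_1(Ω)e_{(x,i′)})(⟨x₁,μ⟩)‖ ≤
N√N·c_H·L·ε·ε^{−d}·e^{−ρ·min(|x₁−x|,|x₂−x|)/L}` from the (I.2.24) Hölder clause at level `1` at good `x₁, x₂` (`G^η_{(0)} = G^ε_1(Ω,A)`;
source `e_{(x,i′)}`: sup `≤ √N`, support `{x}`). [cite: Balaban1983Higgs3, (2.6) p.424, (2.11) p.426] [cite: Balaban1982Higgs1, Prop. 2.1 (2.24) p.610] -/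
theorem holder_pieceR_zero_le (hα : 0 ≤ α) {cH ρ : ℝ}
    (hH : ∀ (g : ScalarField P 0 N) (M D : ℝ), (∀ x, ‖g x‖ ≤ M) → 0 ≤ D →
      ∀ (μ : Fin P.d) (x x' : HiggsLattice.Site P 0), x' ≠ x → good x → good x' →
        ∀ Γ : List (HiggsLattice.Site P 0), IsTChain x Γ →
        pathEnd x Γ = x' → (Γ.length : ℝ) ≤ (P.d : ℝ) * HiggsLattice.Site.tdist x x' →
        (∀ z, g z ≠ 0 → D ≤ (HiggsLattice.Site.tdist x z : ℝ)) → (∀ z, g z ≠ 0 → D ≤ (HiggsLattice.Site.tdist x' z : ℝ)) →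
          (((HiggsLattice.Site.tdist x x' : ℝ) / (P.L : ℝ) ^ 1)⁻¹) ^ α *
              ‖hol C A x Γ (covDeriv C A (propagatorK C Ω A msq a 1 g) ⟨x', μ⟩)
                - covDeriv C A (propagatorK C Ω A msq a 1 g) ⟨x, μ⟩‖
            ≤ cH * P.mesh 1 * Real.exp (-(ρ * (D / (P.L : ℝ) ^ 1))) * M)
    (μ : Fin P.d) {x₁ x₂ : HiggsLattice.Site P 0} (hne : x₂ ≠ x₁) (hx₁ : good x₁) (hx₂ : good x₂) (x : HiggsLattice.Site P 0)
    {Γ : List (HiggsLattice.Site P 0)} (hΓ : IsAdm x₁ x₂ Γ) :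
    (((HiggsLattice.Site.tdist x₁ x₂ : ℝ) / (P.L : ℝ) ^ 0)⁻¹) ^ α * holderTermR C Ω A msq a k 0 μ x₁ x₂ x Γ
      ≤ ((N : ℝ) * Real.sqrt N * cH * (P.L : ℝ)) * (P.mesh 0 * (P.mesh 0 ^ P.d)⁻¹) *
          Real.exp (-(ρ * (min (HiggsLattice.Site.tdist x₁ x : ℝ) (HiggsLattice.Site.tdist x₂ x : ℝ) / (P.L : ℝ) ^ 1))) := by
  set W₀ : ℝ := (((HiggsLattice.Site.tdist x₁ x₂ : ℝ) / (P.L : ℝ) ^ 0)⁻¹) ^ α with hW₀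
  set W₁ : ℝ := (((HiggsLattice.Site.tdist x₁ x₂ : ℝ) / (P.L : ℝ) ^ 1)⁻¹) ^ α with hW₁
  set X := Real.exp (-(ρ * (min (HiggsLattice.Site.tdist x₁ x : ℝ) (HiggsLattice.Site.tdist x₂ x : ℝ) / (P.L : ℝ) ^ 1))) with hX
  have hL1 : (1 : ℝ) ≤ P.L := by exact_mod_cast P.hL
  have ht0 : (0 : ℝ) ≤ (HiggsLattice.Site.tdist x₁ x₂ : ℝ) := Nat.cast_nonneg _
  -- the two weights: `W₀ ≤ W₁` (`(1/t)^α ≤ (L/t)^α`)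
  have hW₀1 : W₀ ≤ W₁ := by
    rw [hW₀, hW₁, pow_zero, div_one, pow_one, inv_div, div_eq_mul_inv]
    exact Real.rpow_le_rpow (inv_nonneg.mpr ht0) (le_mul_of_one_le_left (inv_nonneg.mpr ht0) hL1) hα
  have h1 : ∀ i' : Ix N, W₁ * ‖hol C A x₁ Γ (covDeriv C A (pieceR C Ω A msq a k 0 (cb P N 0 (x, i'))) ⟨x₂, μ⟩)
        - covDeriv C A (pieceR C Ω A msq a k 0 (cb P N 0 (x, i'))) ⟨x₁, μ⟩‖ ≤ cH * P.mesh 1 * X * Real.sqrt N := by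
    intro i'
    rw [pieceR_zero]
    exact hH (cb P N 0 (x, i')) (Real.sqrt N) (min (HiggsLattice.Site.tdist x₁ x : ℝ) (HiggsLattice.Site.tdist x₂ x : ℝ))
      (norm_cb_le _) (le_min (Nat.cast_nonneg _) (Nat.cast_nonneg _)) μ x₁ x₂ hne hx₁ hx₂ Γ hΓ.1 hΓ.2.1 hΓ.2.2
      (fun z hz => by rw [eq_of_cb_ne_zero _ hz]; exact min_le_left _ _)
      (fun z hz => by rw [eq_of_cb_ne_zero _ hz]; exact min_le_right _ _)
  have hsum : W₁ * ∑ i' : Ix N, ‖hol C A x₁ Γ (covDeriv C A (pieceR C Ω A msq a k 0 (cb P N 0 (x, i'))) ⟨x₂, μ⟩)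
        - covDeriv C A (pieceR C Ω A msq a k 0 (cb P N 0 (x, i'))) ⟨x₁, μ⟩‖ ≤ N * (cH * P.mesh 1 * X * Real.sqrt N) := by
    rw [Finset.mul_sum]
    refine (Finset.sum_le_sum fun i' _ => h1 i').trans ?_
    rw [Finset.sum_const, card_Ix, nsmul_eq_mul]
  have hm0 : 0 ≤ (P.mesh 0 ^ P.d)⁻¹ := inv_nonneg.mpr (pow_nonneg (P.mesh_pos 0).le _)
  calc W₀ * holderTermR C Ω A msq a k 0 μ x₁ x₂ x Γ
      ≤ W₁ * holderTermR C Ω A msq a k 0 μ x₁ x₂ x Γ :=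
        mul_le_mul_of_nonneg_right hW₀1 (holderTermR_nonneg C Ω A msq μ x₁ x₂ x Γ)
    _ = (P.mesh 0 ^ P.d)⁻¹ * (W₁ * ∑ i' : Ix N, ‖hol C A x₁ Γ (covDeriv C A (pieceR C Ω A msq a k 0 (cb P N 0 (x, i'))) ⟨x₂, μ⟩)
        - covDeriv C A (pieceR C Ω A msq a k 0 (cb P N 0 (x, i'))) ⟨x₁, μ⟩‖) := by unfold holderTermR; ring
    _ ≤ (P.mesh 0 ^ P.d)⁻¹ * (N * (cH * P.mesh 1 * X * Real.sqrt N)) := mul_le_mul_of_nonneg_left hsum hm0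
    _ = _ := by rw [mesh_eq_pow_mul P 1, pow_one]; ring

/-- **Piece `1 ≤ j < k` on a region**: `(|x₁−x₂|/L^j)^{−α}·ε^{−d}Σ_{i′}‖U(A(Γ))(D^ε_AG^η_{(j)}(Ω,A)e_{(x,i′)})(⟨x₂,μ⟩) − (D^ε_AG^η_{(j)}(Ω,A)e_{(x,i′)})(⟨x₁,μ⟩)‖
≤ N²a²(c_Hc₀)c₁·e^{2δ}(2e^{δ/2})K(δ/2)² · (L^jε)(L^jε)^{−d} · e^{−(δ/2)min(|x₁−x|,|x₂−x|)/L^j}` at good `x₁, x₂, x` — the scaling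
`ε^{−d}·a_j²(L^jε)^{−4}·(L^jε)^{1+2+2}·L^{−jd} = a_j²(L^jε)^{1−d}` of the print's «rescaling from the η-lattice to the L^{−j}-lattice»
(the Hölder weight is already at level `j`). [cite: Balaban1983Higgs3, (2.6) p.424, (2.11) p.426] [cite: Balaban1982Higgs1, (2.43) p.612] -/
theorem holder_pieceR_pos_le (ha : 0 < a) (hL1 : 1 < P.L) (hj1 : 1 ≤ j) (hjk : j < k) (hjK : j ≤ P.K) (hmsq : 0 < msq)
    (hΩ : ∀ x x' : HiggsLattice.Site P 0, blockIter j x = blockIter j x' → (x ∈ Ω ↔ x' ∈ Ω)) (hgood : ∀ x, good x → x ∈ Ω)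
    (hgood' : ∀ (x : HiggsLattice.Site P 0) (μ : Fin P.d), good x → x.shift μ ∈ Ω)
    {c₀ cH c₁ δ : ℝ} (hc₀ : 0 ≤ c₀) (hcH : 0 ≤ cH) (hc₁ : 0 ≤ c₁) (hδ : 0 < δ)
    (hG : ∀ (g : ScalarField P 0 N) (M D : ℝ), (∀ x, ‖g x‖ ≤ M) → 0 ≤ D →
      ∀ x, good x → (∀ z, g z ≠ 0 → D ≤ (HiggsLattice.Site.tdist x z : ℝ)) →
        ‖propagatorK C Ω A msq a j g x‖ ≤ c₀ * P.mesh j ^ 2 * Real.exp (-(δ * (D / (P.L : ℝ) ^ j))) * M)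
    (hH : ∀ (g : ScalarField P 0 N) (M D : ℝ), (∀ x, ‖g x‖ ≤ M) → 0 ≤ D →
      ∀ (μ : Fin P.d) (x x' : HiggsLattice.Site P 0), x' ≠ x → good x → good x' →
        ∀ Γ : List (HiggsLattice.Site P 0), IsTChain x Γ →
        pathEnd x Γ = x' → (Γ.length : ℝ) ≤ (P.d : ℝ) * HiggsLattice.Site.tdist x x' →
        (∀ z, g z ≠ 0 → D ≤ (HiggsLattice.Site.tdist x z : ℝ)) → (∀ z, g z ≠ 0 → D ≤ (HiggsLattice.Site.tdist x' z : ℝ)) →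
          (((HiggsLattice.Site.tdist x x' : ℝ) / (P.L : ℝ) ^ j)⁻¹) ^ α *
              ‖hol C A x Γ (covDeriv C A (propagatorK C Ω A msq a j g) ⟨x', μ⟩)
                - covDeriv C A (propagatorK C Ω A msq a j g) ⟨x, μ⟩‖
            ≤ cH * P.mesh j * Real.exp (-(δ * (D / (P.L : ℝ) ^ j))) * M)
    (hC : ∀ s t : HiggsLattice.Site P j × Ix N, s.1 ∈ levelSet j Ω → t.1 ∈ levelSet j Ω →
      |mat (fluctCovA C Ω A msq a j) s t| ≤ c₁ * P.mesh j ^ 2 * Real.exp (-(δ * (HiggsLattice.Site.tdist s.1 t.1 : ℝ))))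
    (μ : Fin P.d) {x₁ x₂ : HiggsLattice.Site P 0} (hne : x₂ ≠ x₁) (hx₁ : good x₁) (hx₂ : good x₂) {x : HiggsLattice.Site P 0}
    (hx : good x) {Γ : List (HiggsLattice.Site P 0)} (hΓ : IsAdm x₁ x₂ Γ) :
    (((HiggsLattice.Site.tdist x₁ x₂ : ℝ) / (P.L : ℝ) ^ j)⁻¹) ^ α * holderTermR C Ω A msq a k j μ x₁ x₂ x Γ
      ≤ ((N : ℝ) ^ 2 * a ^ 2 * (cH * c₀) * c₁ * (Real.exp δ ^ 2 * (2 * Real.exp (δ / 2)) * profile P N (δ / 2) ^ 2)) *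
        (P.mesh j * (P.mesh j ^ P.d)⁻¹) *
          Real.exp (-(δ / 2 * (min (HiggsLattice.Site.tdist x₁ x : ℝ) (HiggsLattice.Site.tdist x₂ x : ℝ) / (P.L : ℝ) ^ j))) := by
  set W : ℝ := (((HiggsLattice.Site.tdist x₁ x₂ : ℝ) / (P.L : ℝ) ^ j)⁻¹) ^ α with hW
  set X := Real.exp (-(δ / 2 * (min (HiggsLattice.Site.tdist x₁ x : ℝ) (HiggsLattice.Site.tdist x₂ x : ℝ) / (P.L : ℝ) ^ j)))
    with hX
  have hW0 : 0 ≤ W := Real.rpow_nonneg (inv_nonneg.mpr (by positivity)) _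
  have hm0 : 0 < P.mesh 0 := P.mesh_pos 0
  have hmj : 0 < P.mesh j := P.mesh_pos j
  have hLj : (0 : ℝ) < (P.L : ℝ) ^ j := pow_pos (by exact_mod_cast P.hL) j
  have hak : 0 ≤ B1.aSeq a P.L j := (B1.aSeq_pos ha (by exact_mod_cast hL1) hj1).le
  -- one colour: the region sandwich engine with `cH := c_H·L^jε`, `cG := c₀(L^jε)²`, `cC := c₁(L^jε)²`
  have hsw : ∀ i' : Ix N, W * ‖hol C A x₁ Γ (covDeriv C A (pieceR C Ω A msq a k j (cb P N 0 (x, i'))) ⟨x₂, μ⟩)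
        - covDeriv C A (pieceR C Ω A msq a k j (cb P N 0 (x, i'))) ⟨x₁, μ⟩‖
      ≤ coeff221 P a j ^ 2 * ((cH * P.mesh j * Real.exp δ * Real.sqrt N) * (c₀ * P.mesh j ^ 2 * Real.exp δ * Real.sqrt N) *
          (c₁ * P.mesh j ^ 2) * (((P.L : ℝ) ^ j) ^ P.d)⁻¹ * (2 * profile P N (δ / 2) ^ 2 * Real.exp (δ / 2)) * X) := by
    intro i'
    rw [pieceR_of_pos hj1 hjk, LinearMap.smul_apply, covDeriv_smul'', covDeriv_smul'', map_smul, ← smul_sub, norm_smul,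
      Real.norm_eq_abs, abs_of_nonneg (sq_nonneg _), mul_left_comm]
    exact mul_le_mul_of_nonneg_left
      (holder_sandwichR_cb_le C Ω A msq a hjK hmsq hak hΩ hgood hgood' (by positivity) (by positivity) (by positivity) hδ hG hH hC
        (q := (x, i')) hx μ hne hx₁ hx₂ hΓ)
      (sq_nonneg _)
  have hsum : W * ∑ i' : Ix N, ‖hol C A x₁ Γ (covDeriv C A (pieceR C Ω A msq a k j (cb P N 0 (x, i'))) ⟨x₂, μ⟩)
        - covDeriv C A (pieceR C Ω A msq a k j (cb P N 0 (x, i'))) ⟨x₁, μ⟩‖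
      ≤ N * (coeff221 P a j ^ 2 * ((cH * P.mesh j * Real.exp δ * Real.sqrt N) * (c₀ * P.mesh j ^ 2 * Real.exp δ * Real.sqrt N) *
          (c₁ * P.mesh j ^ 2) * (((P.L : ℝ) ^ j) ^ P.d)⁻¹ * (2 * profile P N (δ / 2) ^ 2 * Real.exp (δ / 2)) * X)) := by
    rw [Finset.mul_sum]
    refine (Finset.sum_le_sum fun i' _ => hsw i').trans ?_
    rw [Finset.sum_const, card_Ix, nsmul_eq_mul]
  have hstep : W * holderTermR C Ω A msq a k j μ x₁ x₂ x Γ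
      = (P.mesh 0 ^ P.d)⁻¹ * (W * ∑ i' : Ix N, ‖hol C A x₁ Γ (covDeriv C A (pieceR C Ω A msq a k j (cb P N 0 (x, i'))) ⟨x₂, μ⟩)
        - covDeriv C A (pieceR C Ω A msq a k j (cb P N 0 (x, i'))) ⟨x₁, μ⟩‖) := by unfold holderTermR; ring
  rw [hstep]
  refine (mul_le_mul_of_nonneg_left hsum (inv_nonneg.mpr (pow_nonneg hm0.le _))).trans ?_
  rw [B1Eq243HiggsModel.coeff221_sq]
  have hre : (cH * P.mesh j * Real.exp δ * Real.sqrt N) * (c₀ * P.mesh j ^ 2 * Real.exp δ * Real.sqrt N)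
      = cH * c₀ * P.mesh j ^ 3 * Real.exp δ ^ 2 * N := by
    have h := Real.mul_self_sqrt (Nat.cast_nonneg N : (0 : ℝ) ≤ N)
    calc (cH * P.mesh j * Real.exp δ * Real.sqrt N) * (c₀ * P.mesh j ^ 2 * Real.exp δ * Real.sqrt N)
        = cH * c₀ * P.mesh j ^ 3 * Real.exp δ ^ 2 * (Real.sqrt N * Real.sqrt N) := by ring
      _ = _ := by rw [h]
  rw [hre]
  have hid : (P.mesh 0 ^ P.d)⁻¹ * (N * (B1.aSeq a (P.L : ℝ) j ^ 2 * (P.mesh j ^ 4)⁻¹ *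
        (cH * c₀ * P.mesh j ^ 3 * Real.exp δ ^ 2 * N * (c₁ * P.mesh j ^ 2) *
          (((P.L : ℝ) ^ j) ^ P.d)⁻¹ * (2 * profile P N (δ / 2) ^ 2 * Real.exp (δ / 2)) * X)))
      = B1.aSeq a (P.L : ℝ) j ^ 2 * (((N : ℝ) ^ 2 * a ^ 2 * (cH * c₀) * c₁ *
          (Real.exp δ ^ 2 * (2 * Real.exp (δ / 2)) * profile P N (δ / 2) ^ 2)) * (P.mesh j * (P.mesh j ^ P.d)⁻¹) * X) / a ^ 2 := by
    rw [eq_div_iff (pow_ne_zero 2 ha.ne')]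
    calc (P.mesh 0 ^ P.d)⁻¹ * (N * (B1.aSeq a (P.L : ℝ) j ^ 2 * (P.mesh j ^ 4)⁻¹ *
          (cH * c₀ * P.mesh j ^ 3 * Real.exp δ ^ 2 * N * (c₁ * P.mesh j ^ 2) *
            (((P.L : ℝ) ^ j) ^ P.d)⁻¹ * (2 * profile P N (δ / 2) ^ 2 * Real.exp (δ / 2)) * X))) * a ^ 2
        = B1.aSeq a (P.L : ℝ) j ^ 2 * (((N : ℝ) ^ 2 * a ^ 2 * (cH * c₀) * c₁ *
            (Real.exp δ ^ 2 * (2 * Real.exp (δ / 2)) * profile P N (δ / 2) ^ 2)) * X) *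
            ((P.mesh 0 ^ P.d)⁻¹ * (((P.L : ℝ) ^ j) ^ P.d)⁻¹) * ((P.mesh j ^ 4)⁻¹ * P.mesh j ^ (4 + 1)) := by ring
      _ = _ := by rw [inv_mesh_zero_pow_mul, mesh_pow_cancel, pow_one]; ring
  rw [hid, div_le_iff₀ (pow_pos ha 2)]
  have hrest : 0 ≤ ((N : ℝ) ^ 2 * a ^ 2 * (cH * c₀) * c₁ * (Real.exp δ ^ 2 * (2 * Real.exp (δ / 2)) * profile P N (δ / 2) ^ 2)) *
      (P.mesh j * (P.mesh j ^ P.d)⁻¹) * X := by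
    have hK : 0 ≤ profile P N (δ / 2) := profile_nonneg' _ (by linarith)
    positivity
  calc B1.aSeq a (P.L : ℝ) j ^ 2 * (((N : ℝ) ^ 2 * a ^ 2 * (cH * c₀) * c₁ *
          (Real.exp δ ^ 2 * (2 * Real.exp (δ / 2)) * profile P N (δ / 2) ^ 2)) * (P.mesh j * (P.mesh j ^ P.d)⁻¹) * X)
      ≤ a ^ 2 * (((N : ℝ) ^ 2 * a ^ 2 * (cH * c₀) * c₁ *
          (Real.exp δ ^ 2 * (2 * Real.exp (δ / 2)) * profile P N (δ / 2) ^ 2)) * (P.mesh j * (P.mesh j ^ P.d)⁻¹) * X) :=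
        mul_le_mul_of_nonneg_right (aSeq_sq_le ha hL1 hj1) hrest
    _ = _ := by ring

/-- **Pieces `j ≥ k`, `j ≥ 1` vanish** (no such terms in (2.6)): their Hölder terms are `0`. [cite: Balaban1983Higgs3, (2.6) p.424] -/
theorem holderTermR_eq_zero_of_le (hj1 : 1 ≤ j) (hkj : k ≤ j) (μ : Fin P.d) (x₁ x₂ x : HiggsLattice.Site P 0)
    (Γ : List (HiggsLattice.Site P 0)) : holderTermR C Ω A msq a k j μ x₁ x₂ x Γ = 0 := by
  unfold holderTermR
  simp [pieceR_of_le hj1 hkj, covDeriv_zero'']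

end PieceBoundsR

/-! ## §3 The concrete carrier of B3 (2.10)–(2.11) on a region at a regular non-constant background, with the Hölder fields -/

/-- **The concrete carrier of B3 (2.10)–(2.11) on a REGION `Ω ⊊ T_η` at a REGULAR NON-CONSTANT background `B̃ = A`**: r14 g17's
`regRegionKernels _ C Ω A m² a k K₀` (sites = the interior points `{x // Interior k K₀ Ω x}`, the `R₀`-clause of Proposition I.2.1) with
the two (2.11) fields modelled — `holderDiff j μ x₁ x₂ x` = the supremum over the admissible contours `Γ` from `x₁` to `x₂` (p26's
`IsAdm`) of `ε^{−d}Σ_{i′}‖U(A(Γ))(D^ε_{A,μ}G^η_{(j)}(Ω,A)e_{(x,i′)})(⟨x₂,μ⟩) − (D^ε_{A,μ}G^η_{(j)}(Ω,A)e_{(x,i′)})(⟨x₁,μ⟩)‖` (`holderTermR`), and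
`dist2 x₁ x₂ x = ε·min(|x₁ − x|, |x₂ − x|) = dist({x₁,x₂}, x)`; all other fields as `regRegionKernels` (so (2.5)/(2.12) stay un-modelled).
[cite: Balaban1983Higgs3, (2.6) p.424, (2.10)–(2.11) p.426] [cite: Balaban1982Higgs1, Prop. 2.1 p.610] -/
def regRegionKernelsH (hL1 : 1 < P.L) (C : ChargeData N) (Ω : Finset (HiggsLattice.Site P 0)) (A : HiggsLattice.VecField P 0)
    (msq a : ℝ) (k K₀ : ℕ) : ScaledKernels :=
  { regRegionKernels hL1 C Ω A msq a k K₀ with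
    dist2 := fun x₁ x₂ x =>
      P.mesh 0 * min (HiggsLattice.Site.tdist x₁.1 x.1 : ℝ) (HiggsLattice.Site.tdist x₂.1 x.1 : ℝ)
    holderDiff := fun j μ x₁ x₂ x =>
      ⨆ (Γ : List (HiggsLattice.Site P 0)) (_ : IsAdm x₁.1 x₂.1 Γ), holderTermR C Ω A msq a k j μ x₁.1 x₂.1 x.1 Γ }

section CarrierH

variable {hL1 : 1 < P.L} {C : ChargeData N} {Ω : Finset (HiggsLattice.Site P 0)} {A : HiggsLattice.VecField P 0} {msq a : ℝ}
  {k K₀ : ℕ}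

/-- (2.10) for the Hölder region carrier IS (2.10) for r14 g17's `regRegionKernels` (same sites, distance, scales and kernels).
[cite: Balaban1983Higgs3, (2.10) p.426] -/
theorem ineq210_iff_HR (δ₁ Cst : ℝ) :
    (regRegionKernelsH hL1 C Ω A msq a k K₀).Ineq210 δ₁ Cst ↔ (regRegionKernels hL1 C Ω A msq a k K₀).Ineq210 δ₁ Cst := Iff.rfl

/-- the carrier's `L^jη` is the model's `L^jε`. [cite: Balaban1983Higgs3, (2.11) p.426] -/
theorem scaleHR_eq (j : ℕ) : (regRegionKernelsH hL1 C Ω A msq a k K₀).scale j = P.mesh j := by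
  show (P.L : ℝ) ^ j * P.mesh 0 = P.mesh j
  rw [mesh_eq_pow_mul P j]

/-- the carrier's Hölder field. [cite: Balaban1983Higgs3, (2.11) p.426] -/
theorem regRegionKernelsH_holderDiff (j : ℕ) (μ : Fin P.d) (x₁ x₂ x : {x : HiggsLattice.Site P 0 // Interior k K₀ Ω x}) :
    (regRegionKernelsH hL1 C Ω A msq a k K₀).holderDiff j μ x₁ x₂ x
      = ⨆ (Γ : List (HiggsLattice.Site P 0)) (_ : IsAdm x₁.1 x₂.1 Γ), holderTermR C Ω A msq a k j μ x₁.1 x₂.1 x.1 Γ := rfl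

/-- **Every admissible contour is dominated**: `holderTermR(Γ) ≤ holderDiff` for `Γ` admissible (the supremum is over a set bounded by
the contour-free bound `holderTermR_le_unif`). [cite: Balaban1983Higgs3, (2.11) p.426] -/
theorem holderTermR_le_holderDiff (j : ℕ) (μ : Fin P.d) (x₁ x₂ x : {x : HiggsLattice.Site P 0 // Interior k K₀ Ω x})
    {Γ : List (HiggsLattice.Site P 0)} (hΓ : IsAdm x₁.1 x₂.1 Γ) :
    holderTermR C Ω A msq a k j μ x₁.1 x₂.1 x.1 Γ ≤ (regRegionKernelsH hL1 C Ω A msq a k K₀).holderDiff j μ x₁ x₂ x := by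
  rw [regRegionKernelsH_holderDiff]
  set U : ℝ := (P.mesh 0 ^ P.d)⁻¹ * ∑ i' : Ix N,
      (‖covDeriv C A (pieceR C Ω A msq a k j (cb P N 0 (x.1, i'))) ⟨x₂.1, μ⟩‖
        + ‖covDeriv C A (pieceR C Ω A msq a k j (cb P N 0 (x.1, i'))) ⟨x₁.1, μ⟩‖) with hU
  have hU0 : 0 ≤ U := mul_nonneg (inv_nonneg.mpr (pow_nonneg (P.mesh_pos 0).le _)) (Finset.sum_nonneg fun _ _ => by positivity)
  have hbdd : BddAbove (Set.range fun Γ' : List (HiggsLattice.Site P 0) =>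
      ⨆ (_ : IsAdm x₁.1 x₂.1 Γ'), holderTermR C Ω A msq a k j μ x₁.1 x₂.1 x.1 Γ') := by
    refine ⟨U, ?_⟩
    rintro _ ⟨Γ', rfl⟩
    exact Real.iSup_le (fun _ => holderTermR_le_unif C Ω A msq μ x₁.1 x₂.1 x.1 Γ') hU0
  refine le_ciSup_of_le hbdd Γ ?_
  rw [ciSup_pos hΓ]

/-- kernel: `(L^jη)^{1−d−α} = (L^jη)·((L^jη)^d)^{−1}·((L^jη)^α)^{−1}` (real exponent). [folklore] -/
private theorem rpow_one_sub_sub (j : ℕ) (α : ℝ) :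
    P.mesh j ^ ((1 : ℝ) - (P.d : ℝ) - α) = P.mesh j * (P.mesh j ^ P.d)⁻¹ * (P.mesh j ^ α)⁻¹ := by
  have hs := P.mesh_pos j
  rw [Real.rpow_sub hs, Real.rpow_sub hs, Real.rpow_one, Real.rpow_natCast _ P.d, div_eq_mul_inv, div_eq_mul_inv]

/-- kernel: `(L^jη)^{−1}·(η·m) = m/L^j`. [folklore] -/
private theorem scale_inv_mul (j : ℕ) (m : ℝ) : (P.mesh j)⁻¹ * (P.mesh 0 * m) = m / (P.L : ℝ) ^ j := by
  rw [mesh_eq_pow_mul P j, mul_inv, mul_assoc, ← mul_assoc (P.mesh 0)⁻¹, inv_mul_cancel₀ (P.mesh_pos 0).ne', one_mul,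
    div_eq_inv_mul]

/-- kernel: the weights — `(ε·t)^α·((L^jε)^α)^{−1} = (t/L^j)^α`. [folklore] -/
private theorem weight_eq (j : ℕ) {t α : ℝ} (ht : 0 ≤ t) :
    (P.mesh 0 * t) ^ α * (P.mesh j ^ α)⁻¹ = (t / (P.L : ℝ) ^ j) ^ α := by
  have hm0 : 0 < P.mesh 0 := P.mesh_pos 0
  have hmj : 0 < P.mesh j := P.mesh_pos j
  rw [← Real.inv_rpow hmj.le, ← Real.mul_rpow (mul_nonneg hm0.le ht) (inv_nonneg.mpr hmj.le)]
  congr 1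
  rw [mesh_eq_pow_mul P j, mul_inv, div_eq_mul_inv]
  calc P.mesh 0 * t * (((P.L : ℝ) ^ j)⁻¹ * (P.mesh 0)⁻¹) = t * ((P.L : ℝ) ^ j)⁻¹ * (P.mesh 0 * (P.mesh 0)⁻¹) := by ring
    _ = t * ((P.L : ℝ) ^ j)⁻¹ := by rw [mul_inv_cancel₀ hm0.ne', mul_one]

/-- **Transfer**: Hölder-weighted bounds on every admissible contour's term at interior points, in the model's units, give `Ineq211At`
for the region carrier (`holderDiff` is the supremum; `|x₁ − x₂| = ε·t`, `(t/L^j)^α/(ε t)^α = (L^jε)^{−α}`).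
[cite: Balaban1983Higgs3, (2.11) p.426] -/
theorem ineq211At_of_boundsR {α δ₁ Cst : ℝ} (hCst : 0 ≤ Cst)
    (h : ∀ (j : ℕ) (μ : Fin P.d) (x₁ x₂ x : HiggsLattice.Site P 0), Interior k K₀ Ω x₁ → Interior k K₀ Ω x₂ → Interior k K₀ Ω x →
      x₂ ≠ x₁ → ∀ Γ : List (HiggsLattice.Site P 0), IsAdm x₁ x₂ Γ →
      (((HiggsLattice.Site.tdist x₁ x₂ : ℝ) / (P.L : ℝ) ^ j)⁻¹) ^ α * holderTermR C Ω A msq a k j μ x₁ x₂ x Γ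
        ≤ Cst * (P.mesh j * (P.mesh j ^ P.d)⁻¹) *
          Real.exp (-(δ₁ * (min (HiggsLattice.Site.tdist x₁ x : ℝ) (HiggsLattice.Site.tdist x₂ x : ℝ) / (P.L : ℝ) ^ j)))) :
    (regRegionKernelsH hL1 C Ω A msq a k K₀).Ineq211At α δ₁ Cst := by
  intro j μ x₁ x₂ x hne
  have hne' : x₂.1 ≠ x₁.1 := fun h' => hne (Subtype.ext h'.symm)
  rw [scaleHR_eq, regRegionKernelsH_holderDiff]
  show (⨆ (Γ : List (HiggsLattice.Site P 0)) (_ : IsAdm x₁.1 x₂.1 Γ), holderTermR C Ω A msq a k j μ x₁.1 x₂.1 x.1 Γ) /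
      (P.mesh 0 * (HiggsLattice.Site.tdist x₁.1 x₂.1 : ℝ)) ^ α
    ≤ Cst * P.mesh j ^ ((1 : ℝ) - (P.d : ℝ) - α) *
      Real.exp (-(δ₁ * (P.mesh j)⁻¹ *
        (P.mesh 0 * min (HiggsLattice.Site.tdist x₁.1 x.1 : ℝ) (HiggsLattice.Site.tdist x₂.1 x.1 : ℝ))))
  set t : ℝ := (HiggsLattice.Site.tdist x₁.1 x₂.1 : ℝ) with ht
  set E : ℝ := Real.exp (-(δ₁ * (min (HiggsLattice.Site.tdist x₁.1 x.1 : ℝ) (HiggsLattice.Site.tdist x₂.1 x.1 : ℝ) /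
    (P.L : ℝ) ^ j))) with hE
  have hm0 : 0 < P.mesh 0 := P.mesh_pos 0
  have hmj : 0 < P.mesh j := P.mesh_pos j
  have hLj : (0 : ℝ) < (P.L : ℝ) ^ j := pow_pos (by exact_mod_cast P.hL) j
  have ht1 : 1 ≤ t := by rw [ht]; exact_mod_cast one_le_tdist_of_ne' hne'
  have ht0 : 0 < t := by linarith
  have hu : 0 < t / (P.L : ℝ) ^ j := div_pos ht0 hLj
  have hdist : 0 < (P.mesh 0 * t) ^ α := Real.rpow_pos_of_pos (mul_pos hm0 ht0) _
  have hexp : Real.exp (-(δ₁ * (P.mesh j)⁻¹ *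
      (P.mesh 0 * min (HiggsLattice.Site.tdist x₁.1 x.1 : ℝ) (HiggsLattice.Site.tdist x₂.1 x.1 : ℝ)))) = E := by
    rw [hE, mul_assoc δ₁, scale_inv_mul]
  rw [hexp, div_le_iff₀ hdist]
  -- the right side in the model's units: `Cst·(L^jε)(L^jε)^{−d}·E·(t/L^j)^α`
  have hrhs : Cst * P.mesh j ^ ((1 : ℝ) - (P.d : ℝ) - α) * E * (P.mesh 0 * t) ^ α
      = Cst * (P.mesh j * (P.mesh j ^ P.d)⁻¹) * E * (t / (P.L : ℝ) ^ j) ^ α := by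
    rw [rpow_one_sub_sub, ← weight_eq j ht0.le]; ring
  rw [hrhs]
  have hB0 : 0 ≤ Cst * (P.mesh j * (P.mesh j ^ P.d)⁻¹) * E * (t / (P.L : ℝ) ^ j) ^ α := by positivity
  refine Real.iSup_le (fun Γ => Real.iSup_le (fun hΓ => ?_) hB0) hB0
  -- one admissible contour: divide the weighted bound by the weight `W = ((t/L^j)^α)^{−1}`
  have hW : (((t / (P.L : ℝ) ^ j))⁻¹) ^ α = ((t / (P.L : ℝ) ^ j) ^ α)⁻¹ := Real.inv_rpow hu.le α
  have hWpos : 0 < (t / (P.L : ℝ) ^ j) ^ α := Real.rpow_pos_of_pos hu _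
  have hh := h j μ x₁.1 x₂.1 x.1 x₁.2 x₂.2 x.2 hne' Γ hΓ
  rw [← ht, hW, ← hE, inv_mul_le_iff₀ hWpos] at hh
  calc holderTermR C Ω A msq a k j μ x₁.1 x₂.1 x.1 Γ
      ≤ (t / (P.L : ℝ) ^ j) ^ α * (Cst * (P.mesh j * (P.mesh j ^ P.d)⁻¹) * E) := hh
    _ = _ := by ring

/-- **The whole torus is an admissible region, all of whose points are interior** (`Ω = T_ε`: `IsBigBlockUnion k K₀ T_ε` is
`B1TorusRegionHSizes.isBigBlockUnion_univ`, and the margin condition is empty) — so the region members contain the whole-torus case under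
their own hypotheses. [cite: Balaban1982Higgs1, Prop. 2.1 p.610] -/
theorem interior_univ (k K₀ : ℕ) (x : HiggsLattice.Site P 0) :
    Interior k K₀ (Finset.univ : Finset (HiggsLattice.Site P 0)) x :=
  fun y _ => Finset.mem_univ y

end CarrierH

/-! ## §4 (2.11) PROVED for the region carrier at every fixed Hölder exponent: regular non-constant background, `Ω ⊊ T_η` a big-block
union, interior points, uniformly in the volume -/

section MainHR

/-- **B3 (2.11) p. 426 [PDF 16] PROVED ON A REGION `Ω ⊊ T_η` AT A REGULAR NON-CONSTANT BACKGROUND `B̃ = A`, at interior points, at every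
fixed Hölder exponent, uniformly in the volume.**  For `d ≥ 1`, `L ≥ 2`, `a, m² > 0`, a regularity constant `c ≥ 0` and `N` there is
`E₀ > 0` such that for every charge with `e² ≤ E₀` there is a threshold `K₀,min` (chosen BEFORE `α`) and, for every `0 ≤ α < 1` and every
`K₀ ≥ K₀,min`, constants `t, δ₁, C > 0` (depending on `α` and `K₀`) with: for every volume `P` with these `d, L` and `K₀ ∣ M`, every scale
`1 ≤ k ≤ K` with `L^kε ≤ 1` and `3L^kK₀ ≤ |T_ε|_μ`, every region `Ω ⊂ T_ε` that is a union of big blocks (`IsBigBlockUnion k K₀ Ω`), and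
every configuration `A` that is `δ_A`-regular ON `Ω` (`|A⟨z+e_ν,μ⟩ − A⟨z,μ⟩| ≤ δ_A`, `z ∈ Ω`) with `L^kδ_A|e| ≤ t` and `L^kδ_A ≤ c|e|`:
`(regRegionKernelsH _ C Ω A m² a k K₀).Ineq211At α δ₁ C` — i.e. for all `j`, `μ`, all INTERIOR `x₁ ≠ x₂`, `x`:
`sup_{Γ adm.} ε^{−d}Σ_{i′}‖U(A(Γ))(D^ε_{A,μ}G^η_{(j)}(Ω,A)e_{(x,i′)})(x₂) − (D^ε_{A,μ}G^η_{(j)}(Ω,A)e_{(x,i′)})(x₁)‖ / |x₁ − x₂|^α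
≤ C(L^jη)^{1−d−α}e^{−δ₁(L^jη)^{−1}dist({x₁,x₂},x)}`.
Print: *"This applies also to Hölder norms, e.g. we have (2.11), 0 ≤ α < 1. … They all are obtained by rescaling from the η-lattice
to the L^{−j}-lattice and application of Propositions I.2.1 and I.2.3."*  Route: exactly that — the pieces (2.6) = (I.2.43) for regions
(r14 g17's `pieceR`, `B1Eq243HiggsModel.display243_model`); in each term the transported Hölder difference falls on the first factor and
is bounded through Proposition I.2.1 (2.24) at a regular `A` for big-block regions at interior points
(`B1Ineq224RegularRegion.norm_holder_propagatorK_region_reg_decay_sum`, per-α constants), the other factors through (I.2.25)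
(`B1Ineq225RegularRegion.norm_propagatorK_region_reg_decay_sum`, adjointness `(Q_jG^ε_j)^* = G^ε_jQ_j^*`) and (I.2.34) for regions
(`B1Prop23RegularRegion.prop23_regular_region`, read on `Λ = Ω^{(l)}` through r14 g17's `mat_condCov232_levelSet` on the constant tower
`towerR Ω k`), the three-kernel convolution on `T^{(j)}` from `x₁` and from `x₂`; the piece `G^η_{(0)} = G^ε_1(Ω,A)` is (2.24) at level `1`;
sources in blocks outside `Ω` do not reach `Ω`.  Honest scope: interior points only (all three of `x₁, x₂, x`); `m² > 0`; `Ω` a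
big-block union with the cube-count hypothesis and `K₀ ∣ M`; `e² ≤ E₀`; no parity condition on `L`; constants depend on `α` and on `K₀`
(and on the charge data through the inputs; GAPS G-B3-11); `holderDiff` is the supremum over the admissible contours `|Γ| ≤ d·|x₁ − x₂|`.
[cite: Balaban1983Higgs3, (2.6) p.424, (2.11) p.426] [cite: Balaban1982Higgs1, Prop. 2.1 (2.24)–(2.25) p.610, Prop. 2.3 (2.34) p.611, (2.43) p.612] -/
theorem ineq211At_regularRegion (d L : ℕ) (hd : 1 ≤ d) (hL : 2 ≤ L) {a : ℝ} (ha : 0 < a) {msq : ℝ} (hmsq : 0 < msq)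
    {c : ℝ} (hc : 0 ≤ c) (N : ℕ) :
    ∃ E₀ : ℝ, 0 < E₀ ∧ ∀ (C : ChargeData N), C.e ^ 2 ≤ E₀ →
      ∃ K₀min : ℕ, ∀ {α : ℝ}, 0 ≤ α → α < 1 → ∀ K₀ : ℕ, K₀min ≤ K₀ → ∃ t δ₁ Cst : ℝ, 0 < t ∧ 0 < δ₁ ∧ 0 < Cst ∧
      ∀ (P : HiggsLattice.Params) (hP1 : 1 < P.L), P.d = d → P.L = L → K₀ ∣ P.M →
      ∀ {k : ℕ}, 1 ≤ k → k ≤ P.K → (∀ μ, 3 * half P k K₀ ≤ P.sitesPerDir 0 μ) → P.mesh k ≤ 1 →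
      ∀ (Ω : Finset (HiggsLattice.Site P 0)), IsBigBlockUnion k K₀ Ω →
      ∀ (A : HiggsLattice.VecField P 0) {δA : ℝ}, 0 ≤ δA →
        (∀ z ∈ Ω, ∀ μ ν : Fin P.d, |A ⟨z.shift ν, μ⟩ - A ⟨z, μ⟩| ≤ δA) →
        (P.L : ℝ) ^ k * δA * |C.e| ≤ t → (P.L : ℝ) ^ k * δA ≤ c * |C.e| →
        (regRegionKernelsH hP1 C Ω A msq a k K₀).Ineq211At α δ₁ Cst := by
  have hL1 : 1 < L := by omega
  obtain ⟨E₀, c₁, ρ₃, hE₀, hc₁, hρ₃, hCov⟩ := B1Prop23RegularRegion.prop23_regular_region d L hL1 ha hmsq hc N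
  refine ⟨E₀, hE₀, fun C heE => ?_⟩
  obtain ⟨K₁, hV⟩ :=
    B1Ineq225RegularRegion.norm_propagatorK_region_reg_decay_sum d L hd hL ha hmsq N C 1 1 1 zero_le_one one_pos
  obtain ⟨K₄, hHol⟩ :=
    B1Ineq224RegularRegion.norm_holder_propagatorK_region_reg_decay_sum d L hd hL ha hmsq N C 1 1 1 zero_le_one one_pos
  refine ⟨max (max K₁ K₄) 1, fun {α} hα0 hα1 K₀ hK₀ => ?_⟩
  have hK₁ : K₁ ≤ K₀ := ((le_max_left _ _).trans (le_max_left _ _)).trans hK₀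
  have hK₄ : K₄ ≤ K₀ := ((le_max_right _ _).trans (le_max_left _ _)).trans hK₀
  have hK₀1 : 1 ≤ K₀ := (le_max_right _ _).trans hK₀
  obtain ⟨c₀, e₁, hc₀, he₁, hV⟩ := hV K₀ hK₁
  obtain ⟨cH, eH, hcH, heH, hH⟩ := hHol hα0 hα1 K₀ hK₄
  -- the common rate, the smallness threshold and the constant
  obtain ⟨δ, hδ⟩ : ∃ δ : ℝ, δ = min (1 / (4 * (K₀ : ℝ))) ρ₃ := ⟨_, rfl⟩
  have hδpos : 0 < δ := by rw [hδ]; exact lt_min (by positivity) hρ₃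
  have hδ₁ : δ ≤ 1 / (4 * K₀) := by rw [hδ]; exact min_le_left _ _
  have hδ₃ : δ ≤ ρ₃ := by rw [hδ]; exact min_le_right _ _
  have hLpos : (0 : ℝ) < L := by exact_mod_cast (by omega : 0 < L)
  refine ⟨min e₁ eH, δ / (2 * L), cst211 d L N a c₀ cH c₁ δ, lt_min he₁ heH, div_pos hδpos (by positivity),
    cst211_pos hc₀.le hcH.le hc₁.le, ?_⟩
  intro P hP1 hPd hPL hK₀M k hk1 hkK h3 hmesh Ω hΩ A δA hδA hreg ht hcA
  subst hPd hPL
  have hL1' : 1 < P.L := hP1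
  have hLr : 1 < (P.L : ℝ) := by exact_mod_cast hL1'
  have hLge1 : (1 : ℝ) ≤ P.L := hLr.le
  have hCst : 0 ≤ cst211 P.d P.L N a c₀ cH c₁ δ := (cst211_pos hc₀.le hcH.le hc₁.le).le
  have hte₁ : (P.L : ℝ) ^ k * δA * |C.e| ≤ e₁ := ht.trans (min_le_left _ _)
  have hteH : (P.L : ℝ) ^ k * δA * |C.e| ≤ eH := ht.trans (min_le_right _ _)
  -- block-union facts at every level `l ≤ k`
  have hΩl : ∀ {l : ℕ}, l ≤ k → ∀ x x' : HiggsLattice.Site P 0, blockIter l x = blockIter l x' → (x ∈ Ω ↔ x' ∈ Ω) :=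
    fun hl => blockUnion_of_isBigBlockUnion hl hΩ
  -- (I.2.25) value at level `l`, engine form, at interior points
  have hGl : ∀ {l : ℕ}, 1 ≤ l → l ≤ k → ∀ (g : ScalarField P 0 N) (M D : ℝ), (∀ x, ‖g x‖ ≤ M) → 0 ≤ D →
      ∀ x, Interior k K₀ Ω x → (∀ z, g z ≠ 0 → D ≤ (HiggsLattice.Site.tdist x z : ℝ)) →
        ‖propagatorK C Ω A msq a l g x‖ ≤ c₀ * P.mesh l ^ 2 * Real.exp (-(δ * (D / (P.L : ℝ) ^ l))) * M := by
    intro l hl1 hlk g M D hg hD0 x hx hsupp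
    have hmesh_l : P.mesh l ≤ 1 := (mesh_mono P hlk).trans hmesh
    have h3l : ∀ μ, 3 * half P l K₀ ≤ P.sitesPerDir 0 μ := fun μ => (Nat.mul_le_mul_left _ (half_mono hlk)).trans (h3 μ)
    have hak : 0 ≤ B1.aSeq a P.L l := (B1.aSeq_pos ha hLr hl1).le
    have h := hV P rfl rfl hK₀M hl1 (hlk.trans hkK) h3l hmesh_l Ω (isBigBlockUnion_of_le hlk hΩ) A he₁ le_rfl
      (reg223R_of_small C Ω A hlk hmesh_l he₁ hδA hreg hte₁ le_rfl) x (hx.margin hlk) g M D hg hD0 hsupp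
    rw [← propagatorK_apply_eq_chi C A hmsq hak (hΩl hlk) g hx.mem] at h
    refine h.trans ?_
    have hM : 0 ≤ M := (norm_nonneg _).trans (hg x)
    have hLl : (0 : ℝ) < (P.L : ℝ) ^ l := pow_pos (by exact_mod_cast P.hL) l
    have hexp := exp_p35_le (P := P) (by omega : 0 < K₀) hδ₁ hD0 hLl
    exact mul_le_mul_of_nonneg_right (mul_le_mul_of_nonneg_left hexp (by positivity)) hM
  -- (I.2.24) Hölder at level `l`, engine form, at interior row points
  have hHl : ∀ {l : ℕ}, 1 ≤ l → l ≤ k → ∀ (g : ScalarField P 0 N) (M D : ℝ), (∀ x, ‖g x‖ ≤ M) → 0 ≤ D →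
      ∀ (μ : Fin P.d) (x x' : HiggsLattice.Site P 0), x' ≠ x → Interior k K₀ Ω x → Interior k K₀ Ω x' →
        ∀ Γ : List (HiggsLattice.Site P 0), IsTChain x Γ →
        pathEnd x Γ = x' → (Γ.length : ℝ) ≤ (P.d : ℝ) * HiggsLattice.Site.tdist x x' →
        (∀ z, g z ≠ 0 → D ≤ (HiggsLattice.Site.tdist x z : ℝ)) → (∀ z, g z ≠ 0 → D ≤ (HiggsLattice.Site.tdist x' z : ℝ)) →
          (((HiggsLattice.Site.tdist x x' : ℝ) / (P.L : ℝ) ^ l)⁻¹) ^ α *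
              ‖hol C A x Γ (covDeriv C A (propagatorK C Ω A msq a l g) ⟨x', μ⟩)
                - covDeriv C A (propagatorK C Ω A msq a l g) ⟨x, μ⟩‖
            ≤ cH * P.mesh l * Real.exp (-(δ * (D / (P.L : ℝ) ^ l))) * M := by
    intro l hl1 hlk g M D hg hD0 μ x x' hne hx hx' Γ hch hend hlen hDx hDx'
    have hmesh_l : P.mesh l ≤ 1 := (mesh_mono P hlk).trans hmesh
    have h3l : ∀ μ, 3 * half P l K₀ ≤ P.sitesPerDir 0 μ := fun μ => (Nat.mul_le_mul_left _ (half_mono hlk)).trans (h3 μ)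
    have hak : 0 ≤ B1.aSeq a P.L l := (B1.aSeq_pos ha hLr hl1).le
    have h := hH P rfl rfl hK₀M hl1 (hlk.trans hkK) h3l hmesh_l Ω (isBigBlockUnion_of_le hlk hΩ) A heH le_rfl
      (reg223R_of_small C Ω A hlk hmesh_l heH hδA hreg hteH le_rfl) μ x x' hne (hx.margin' hlk) (hx'.margin' hlk) Γ hch hend hlen
      g M D hg hD0 hDx hDx'
    -- `D^ε_A(G(1_Ωg))` and `D^ε_A(Gg)` agree at bonds starting at interior points
    have hcut : ∀ y ∈ Ω, propagatorK C Ω A msq a l (chi Ω • g) y = propagatorK C Ω A msq a l g y :=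
      fun y hy => (propagatorK_apply_eq_chi C A hmsq hak (hΩl hlk) g hy).symm
    have hD' : ∀ {y : HiggsLattice.Site P 0}, Interior k K₀ Ω y →
        covDeriv C A (propagatorK C Ω A msq a l (chi Ω • g)) ⟨y, μ⟩ = covDeriv C A (propagatorK C Ω A msq a l g) ⟨y, μ⟩ :=
      fun {y} hy => covDeriv_congr_bond C A (hcut _ hy.mem) (hcut _ (hy.shift_mem μ))
    rw [hD' hx, hD' hx'] at h
    refine h.trans ?_
    have hM : 0 ≤ M := (norm_nonneg _).trans (hg x)
    have hml : 0 < P.mesh l := P.mesh_pos l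
    have hLl : (0 : ℝ) < (P.L : ℝ) ^ l := pow_pos (by exact_mod_cast P.hL) l
    have hexp := exp_p35_le (P := P) (by omega : 0 < K₀) hδ₁ hD0 hLl
    exact mul_le_mul_of_nonneg_right (mul_le_mul_of_nonneg_left hexp (by positivity)) hM
  -- (I.2.34) at level `l < k` on `Ω^{(l)} × Ω^{(l)}` (r14 g14's region form on the constant tower, as in the region (2.10))
  have hCl : ∀ {l : ℕ}, 1 ≤ l → l < k → ∀ s t : HiggsLattice.Site P l × Ix N, s.1 ∈ levelSet l Ω → t.1 ∈ levelSet l Ω →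
      |mat (fluctCovA C Ω A msq a l) s t| ≤ c₁ * P.mesh l ^ 2 * Real.exp (-(δ * (HiggsLattice.Site.tdist s.1 t.1 : ℝ))) := by
    intro l hl1 hlk s t hs ht'
    obtain ⟨j, rfl⟩ : ∃ j, l = j + 1 := ⟨l - 1, by omega⟩
    have hmesh_l : P.mesh (j + 1) ≤ 1 := (mesh_mono P hlk.le).trans hmesh
    have hjK : j + 1 < P.K := lt_of_lt_of_le hlk hkK
    have hcl : (P.L : ℝ) ^ (j + 1) * δA ≤ c * |C.e| := by
      have hpow : (P.L : ℝ) ^ (j + 1) ≤ (P.L : ℝ) ^ k := pow_le_pow_right₀ hLge1 hlk.le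
      nlinarith
    have hjk : j < k := by omega
    have hpf : B2Eq328ConcretePieces.pieceF (towerR Ω k) ⟨j, hjk⟩ = Ω := pieceF_towerR ⟨j, hjk⟩ (hΩl hlk.le)
    have hregF : ∀ z ∈ B2Eq328ConcretePieces.pieceF (towerR Ω k) ⟨j, hjk⟩, ∀ μ' ν : Fin P.d,
        |A ⟨z.shift ν, μ'⟩ - A ⟨z, μ'⟩| ≤ δA := by
      rw [hpf]; exact hreg
    have hj2 : j + 2 ≤ k := by omega
    have hΛ := levelSet_blockUnion hjK.le (hΩl hlk.le) (hΩl hj2)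
    have h := (hCov C heE P rfl rfl (towerR Ω k) hkK ⟨j, hjk⟩ hjK hmesh_l hΛ A hδA hregF hcl (Λ := levelSet (j + 1) Ω)
      (subset_refl _) hs ht').1
    rw [hpf, mat_condCov232_levelSet C A hjK.le hmsq ha hLr (hΩl hlk.le) (hΩl hj2) hs] at h
    refine h.trans ?_
    have hexp : Real.exp (-(ρ₃ * (HiggsLattice.Site.tdist s.1 t.1 : ℝ))) ≤
        Real.exp (-(δ * (HiggsLattice.Site.tdist s.1 t.1 : ℝ))) :=
      exp_le_exp_of_le (mul_le_mul_of_nonneg_right hδ₃ (Nat.cast_nonneg _))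
    calc P.mesh (j + 1) ^ 2 * c₁ * Real.exp (-(ρ₃ * (HiggsLattice.Site.tdist s.1 t.1 : ℝ)))
        ≤ P.mesh (j + 1) ^ 2 * c₁ * Real.exp (-(δ * (HiggsLattice.Site.tdist s.1 t.1 : ℝ))) :=
          mul_le_mul_of_nonneg_left hexp (by positivity)
      _ = _ := by ring
  -- rate bookkeeping: `δ/(2L) ≤ δ/2` and the `j = 0` exponent (rate `δ` at level `1` beats rate `δ/(2L)` at level `0`)
  have hrate : δ / (2 * P.L) ≤ δ / 2 := by
    rw [div_le_div_iff₀ (by positivity) (by norm_num : (0 : ℝ) < 2)]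
    nlinarith
  have hexp0 : ∀ m : ℝ, 0 ≤ m →
      Real.exp (-(δ * (m / (P.L : ℝ) ^ 1))) ≤ Real.exp (-(δ / (2 * P.L) * (m / (P.L : ℝ) ^ 0))) := by
    intro m hm
    apply exp_le_exp_of_le
    rw [pow_one, pow_zero, div_one]
    have h0 : 0 ≤ δ * (m / P.L) := by positivity
    calc δ / (2 * P.L) * m = (1 / 2) * (δ * (m / P.L)) := by ring
      _ ≤ δ * (m / P.L) := by linarith
  have hexpj : ∀ (j : ℕ) (m : ℝ), 0 ≤ m →
      Real.exp (-(δ / 2 * (m / (P.L : ℝ) ^ j))) ≤ Real.exp (-(δ / (2 * P.L) * (m / (P.L : ℝ) ^ j))) :=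
    fun j m hm => exp_rate_mono hrate (by positivity)
  have hgood : ∀ x, Interior k K₀ Ω x → x ∈ Ω := fun x hx => hx.mem
  have hgood' : ∀ (x : HiggsLattice.Site P 0) (μ : Fin P.d), Interior k K₀ Ω x → x.shift μ ∈ Ω :=
    fun x μ hx => hx.shift_mem μ
  refine ineq211At_of_boundsR hCst (fun j μ x₁ x₂ x hx₁ hx₂ hx hne Γ hΓ => ?_)
  have hmj : 0 < P.mesh j := P.mesh_pos j
  have hmin : 0 ≤ min (HiggsLattice.Site.tdist x₁ x : ℝ) (HiggsLattice.Site.tdist x₂ x : ℝ) :=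
    le_min (Nat.cast_nonneg _) (Nat.cast_nonneg _)
  rcases Nat.eq_zero_or_pos j with rfl | hj1
  · -- the piece `G^η_{(0)} = G^ε_1(Ω,A)`: (I.2.24) at level `1`
    refine (holder_pieceR_zero_le C Ω A msq (k := k) hα0 (hHl le_rfl hk1) μ hne hx₁ hx₂ x hΓ).trans ?_
    exact mul_le_mul (mul_le_mul_of_nonneg_right (le_cst211_zero hc₀.le hcH.le hc₁.le) (by positivity)) (hexp0 _ hmin)
      (Real.exp_pos _).le (by positivity)
  · by_cases hjk : j < k
    · refine (holder_pieceR_pos_le C Ω A msq ha hL1' hj1 hjk (hjk.le.trans hkK) hmsq (hΩl hjk.le) hgood hgood' hc₀.le hcH.le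
        hc₁.le hδpos (hGl hj1 hjk.le) (hHl hj1 hjk.le) (hCl hj1 hjk) μ hne hx₁ hx₂ hx hΓ).trans ?_
      exact mul_le_mul (mul_le_mul_of_nonneg_right (le_cst211_pos hc₀.le hcH.le hc₁.le) (by positivity)) (hexpj j _ hmin)
        (Real.exp_pos _).le (by positivity)
    · rw [holderTermR_eq_zero_of_le C Ω A msq hj1 (not_lt.mp hjk), mul_zero]
      positivity

/-- **The same, un-subtyped** (r15's request of 2026-08-22T19:56:56Z, as for the region (2.10)): (2.11) on the region for every `j`,
every direction, all `x₁ ≠ x₂`, `x ∈ T_ε` carrying the interior margin and EVERY admissible contour `Γ` from `x₁` to `x₂`, in the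
model's units (`(L^jε)^{1−d−α}`, rate `δ₁(L^jε)^{−1}·ε·min(|x₁ − x|, |x₂ − x|)`) — the form consumers on the full lattice use.
[cite: Balaban1983Higgs3, (2.11) p.426] [cite: Balaban1982Higgs1, Prop. 2.1 p.610] -/
theorem ineq211At_regularRegion_explicit (d L : ℕ) (hd : 1 ≤ d) (hL : 2 ≤ L) {a : ℝ} (ha : 0 < a) {msq : ℝ} (hmsq : 0 < msq)
    {c : ℝ} (hc : 0 ≤ c) (N : ℕ) :
    ∃ E₀ : ℝ, 0 < E₀ ∧ ∀ (C : ChargeData N), C.e ^ 2 ≤ E₀ →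
      ∃ K₀min : ℕ, ∀ {α : ℝ}, 0 ≤ α → α < 1 → ∀ K₀ : ℕ, K₀min ≤ K₀ → ∃ t δ₁ Cst : ℝ, 0 < t ∧ 0 < δ₁ ∧ 0 < Cst ∧
      ∀ (P : HiggsLattice.Params), 1 < P.L → P.d = d → P.L = L → K₀ ∣ P.M →
      ∀ {k : ℕ}, 1 ≤ k → k ≤ P.K → (∀ μ, 3 * half P k K₀ ≤ P.sitesPerDir 0 μ) → P.mesh k ≤ 1 →
      ∀ (Ω : Finset (HiggsLattice.Site P 0)), IsBigBlockUnion k K₀ Ω →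
      ∀ (A : HiggsLattice.VecField P 0) {δA : ℝ}, 0 ≤ δA →
        (∀ z ∈ Ω, ∀ μ ν : Fin P.d, |A ⟨z.shift ν, μ⟩ - A ⟨z, μ⟩| ≤ δA) →
        (P.L : ℝ) ^ k * δA * |C.e| ≤ t → (P.L : ℝ) ^ k * δA ≤ c * |C.e| →
        ∀ (j : ℕ) (μ : Fin P.d) (x₁ x₂ x : HiggsLattice.Site P 0), Interior k K₀ Ω x₁ → Interior k K₀ Ω x₂ → Interior k K₀ Ω x →
          x₁ ≠ x₂ → ∀ Γ : List (HiggsLattice.Site P 0), IsAdm x₁ x₂ Γ →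
          holderTermR C Ω A msq a k j μ x₁ x₂ x Γ / (P.mesh 0 * (HiggsLattice.Site.tdist x₁ x₂ : ℝ)) ^ α
            ≤ Cst * P.mesh j ^ ((1 : ℝ) - (P.d : ℝ) - α) *
              Real.exp (-(δ₁ * (P.mesh j)⁻¹ *
                (P.mesh 0 * min (HiggsLattice.Site.tdist x₁ x : ℝ) (HiggsLattice.Site.tdist x₂ x : ℝ)))) := by
  obtain ⟨E₀, hE₀, h⟩ := ineq211At_regularRegion d L hd hL ha hmsq hc N
  refine ⟨E₀, hE₀, fun C heE => ?_⟩
  obtain ⟨K₀min, h⟩ := h C heE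
  refine ⟨K₀min, fun {α} hα0 hα1 K₀ hK₀ => ?_⟩
  obtain ⟨t, δ₁, Cst, ht, hδ₁, hCst, h⟩ := h hα0 hα1 K₀ hK₀
  refine ⟨t, δ₁, Cst, ht, hδ₁, hCst, ?_⟩
  intro P hP1 hPd hPL hK₀M k hk1 hkK h3 hmesh Ω hΩ A δA hδA hreg ht' hcA j μ x₁ x₂ x hx₁ hx₂ hx hne Γ hΓ
  have h' := h P hP1 hPd hPL hK₀M hk1 hkK h3 hmesh Ω hΩ A hδA hreg ht' hcA j μ ⟨x₁, hx₁⟩ ⟨x₂, hx₂⟩ ⟨x, hx⟩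
    (fun heq => hne (congrArg Subtype.val heq))
  rw [scaleHR_eq] at h'
  have hdist : 0 ≤ (P.mesh 0 * (HiggsLattice.Site.tdist x₁ x₂ : ℝ)) ^ α :=
    Real.rpow_nonneg (mul_nonneg (P.mesh_pos 0).le (Nat.cast_nonneg _)) _
  exact le_trans (div_le_div_of_nonneg_right
    (holderTermR_le_holderDiff (hL1 := hP1) (C := C) (Ω := Ω) (A := A) (msq := msq) (a := a) (k := k) (K₀ := K₀) j μ
      ⟨x₁, hx₁⟩ ⟨x₂, hx₂⟩ ⟨x, hx⟩ hΓ) hdist) h'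

/-- **(2.10) and (2.11) on the SAME region carrier**: under the hypotheses of both theorems (the charge threshold, the cube threshold
and the smallness `t` taken for both), `regRegionKernelsH` satisfies r14 g17's region (2.10) (through `ineq210_iff_HR`) and (2.11) at the
fixed exponent `α`. [cite: Balaban1983Higgs3, (2.10)–(2.11) p.426] -/
theorem ineq210_and_211At_regularRegionH (d L : ℕ) (hd : 1 ≤ d) (hL : 2 ≤ L) {a : ℝ} (ha : 0 < a) {msq : ℝ} (hmsq : 0 < msq)
    {c : ℝ} (hc : 0 ≤ c) (N : ℕ) :
    ∃ E₀ : ℝ, 0 < E₀ ∧ ∀ (C : ChargeData N), C.e ^ 2 ≤ E₀ →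
      ∃ K₀min : ℕ, ∀ {α : ℝ}, 0 ≤ α → α < 1 → ∀ K₀ : ℕ, K₀min ≤ K₀ → ∃ t δ₁ Cst : ℝ, 0 < t ∧ 0 < δ₁ ∧ 0 < Cst ∧
      ∀ (P : HiggsLattice.Params) (hP1 : 1 < P.L), P.d = d → P.L = L → K₀ ∣ P.M →
      ∀ {k : ℕ}, 1 ≤ k → k ≤ P.K → (∀ μ, 3 * half P k K₀ ≤ P.sitesPerDir 0 μ) → P.mesh k ≤ 1 →
      ∀ (Ω : Finset (HiggsLattice.Site P 0)), IsBigBlockUnion k K₀ Ω →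
      ∀ (A : HiggsLattice.VecField P 0) {δA : ℝ}, 0 ≤ δA →
        (∀ z ∈ Ω, ∀ μ ν : Fin P.d, |A ⟨z.shift ν, μ⟩ - A ⟨z, μ⟩| ≤ δA) →
        (P.L : ℝ) ^ k * δA * |C.e| ≤ t → (P.L : ℝ) ^ k * δA ≤ c * |C.e| →
        (regRegionKernelsH hP1 C Ω A msq a k K₀).Ineq210 δ₁ Cst ∧
          (regRegionKernelsH hP1 C Ω A msq a k K₀).Ineq211At α δ₁ Cst := by
  obtain ⟨E₁, hE₁, h₁⟩ := ineq210_regularRegion d L hd hL ha hmsq hc N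
  obtain ⟨E₂, hE₂, h₂⟩ := ineq211At_regularRegion d L hd hL ha hmsq hc N
  refine ⟨min E₁ E₂, lt_min hE₁ hE₂, fun C heE => ?_⟩
  obtain ⟨K₁, h₁⟩ := h₁ C (heE.trans (min_le_left _ _))
  obtain ⟨K₂, h₂⟩ := h₂ C (heE.trans (min_le_right _ _))
  refine ⟨max K₁ K₂, fun {α} hα0 hα1 K₀ hK₀ => ?_⟩
  obtain ⟨t₁, δ₁, C₁, ht₁, hδ₁, hC₁, h₁⟩ := h₁ K₀ ((le_max_left _ _).trans hK₀)
  obtain ⟨t₂, δ₂, C₂, ht₂, hδ₂, hC₂, h₂⟩ := h₂ hα0 hα1 K₀ ((le_max_right _ _).trans hK₀)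
  refine ⟨min t₁ t₂, min δ₁ δ₂, max C₁ C₂, lt_min ht₁ ht₂, lt_min hδ₁ hδ₂, lt_max_of_lt_left hC₁, ?_⟩
  intro P hP1 hPd hPL hK₀M k hk1 hkK h3 hmesh Ω hΩ A δA hδA hreg ht hcA
  have hA := h₁ P hP1 hPd hPL hK₀M hk1 hkK h3 hmesh Ω hΩ A hδA hreg (ht.trans (min_le_left _ _)) hcA
  have hB := h₂ P hP1 hPd hPL hK₀M hk1 hkK h3 hmesh Ω hΩ A hδA hreg (ht.trans (min_le_right _ _)) hcA
  -- weakening of the constants: a smaller rate and a larger constant preserve both displays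
  have hscale : ∀ j, 0 < (regRegionKernelsH hP1 C Ω A msq a k K₀).scale j := fun j => by
    rw [scaleHR_eq]; exact P.mesh_pos j
  refine ⟨?_, ?_⟩
  · rw [ineq210_iff_HR]
    intro j x x'
    obtain ⟨hv, hd'⟩ := hA j x x'
    have hs : 0 < (regRegionKernels hP1 C Ω A msq a k K₀).scale j := hscale j
    have hdist : 0 ≤ (regRegionKernels hP1 C Ω A msq a k K₀).dist x x' := by
      show 0 ≤ P.mesh 0 * (HiggsLattice.Site.tdist x.1 x'.1 : ℝ)
      exact mul_nonneg (P.mesh_pos 0).le (Nat.cast_nonneg _)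
    have hexp : Real.exp (-(δ₁ * ((regRegionKernels hP1 C Ω A msq a k K₀).scale j)⁻¹ *
          (regRegionKernels hP1 C Ω A msq a k K₀).dist x x'))
        ≤ Real.exp (-(min δ₁ δ₂ * ((regRegionKernels hP1 C Ω A msq a k K₀).scale j)⁻¹ *
          (regRegionKernels hP1 C Ω A msq a k K₀).dist x x')) := by
      rw [mul_assoc, mul_assoc]
      exact exp_rate_mono (min_le_left _ _) (mul_nonneg (inv_nonneg.mpr hs.le) hdist)
    refine ⟨hv.trans ?_, fun μ => (hd' μ).trans ?_⟩
    · exact mul_le_mul (mul_le_mul_of_nonneg_right (le_max_left _ _) (Real.rpow_nonneg hs.le _)) hexp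
        (Real.exp_pos _).le (mul_nonneg (le_trans hC₁.le (le_max_left _ _)) (Real.rpow_nonneg hs.le _))
    · exact mul_le_mul (mul_le_mul_of_nonneg_right (le_max_left _ _) (Real.rpow_nonneg hs.le _)) hexp
        (Real.exp_pos _).le (mul_nonneg (le_trans hC₁.le (le_max_left _ _)) (Real.rpow_nonneg hs.le _))
  · intro j μ x₁ x₂ x hne
    have h := hB j μ x₁ x₂ x hne
    have hs : 0 < (regRegionKernelsH hP1 C Ω A msq a k K₀).scale j := hscale j
    have hdist2 : 0 ≤ (regRegionKernelsH hP1 C Ω A msq a k K₀).dist2 x₁ x₂ x := by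
      show 0 ≤ P.mesh 0 * min (HiggsLattice.Site.tdist x₁.1 x.1 : ℝ) (HiggsLattice.Site.tdist x₂.1 x.1 : ℝ)
      exact mul_nonneg (P.mesh_pos 0).le (le_min (Nat.cast_nonneg _) (Nat.cast_nonneg _))
    have hexp : Real.exp (-(δ₂ * ((regRegionKernelsH hP1 C Ω A msq a k K₀).scale j)⁻¹ *
          (regRegionKernelsH hP1 C Ω A msq a k K₀).dist2 x₁ x₂ x))
        ≤ Real.exp (-(min δ₁ δ₂ * ((regRegionKernelsH hP1 C Ω A msq a k K₀).scale j)⁻¹ *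
          (regRegionKernelsH hP1 C Ω A msq a k K₀).dist2 x₁ x₂ x)) := by
      rw [mul_assoc, mul_assoc]
      exact exp_rate_mono (min_le_right _ _) (mul_nonneg (inv_nonneg.mpr hs.le) hdist2)
    refine h.trans ?_
    exact mul_le_mul (mul_le_mul_of_nonneg_right (le_max_right _ _) (Real.rpow_nonneg hs.le _)) hexp
      (Real.exp_pos _).le (mul_nonneg (le_trans hC₂.le (le_max_right _ _)) (Real.rpow_nonneg hs.le _))

end MainHR

/-! ## §5 (2.11) on the region carrier with ONE smallness parameter `L^kδ_A·|e|` (v1.1)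

v1.1 (p35 gen 16, APPEND-ONLY: every v1.0 declaration and locator unchanged — the one new `import` takes the blank line 4):
**`ineq211At_regularRegion_small`** / **`ineq211At_regularRegion_small_explicit`** — the same (2.11) region member with ONE smallness
parameter `L^kδ_A·|e| ≤ t`: the hypotheses `e² ≤ E₀` and `L^kδ_A ≤ c|e|` of v1.0 (the packaging of r14 g14's region (I.2.34)) are dropped,
the (I.2.34) block being fed by p35 g16's one-parameter region form `B1Prop23RegularRegionSmall.prop23_regular_region_small` (the region
twin of r14 g13's torus assembly `B1Props21to23RegularTorus.ineq234_236_regular_torus`); `K₀,min` and the constants are chosen after the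
charge data as before; the (2.10) ∧ (2.11) conjunction `ineq210_and_211At_regularRegionH` keeps v1.0's hypotheses (r14 g17's region (2.10)
is stated in the `(E₀, c)` packaging).

statement-level skeleton of published theorems with citation tags; proofs where landed; nothing here is a claim about the Yang–Mills mass gap -/

section SmallHR

/-- **B3 (2.11) p. 426 ON A REGION `Ω ⊊ T_η` AT A REGULAR NON-CONSTANT BACKGROUND, ONE SMALLNESS PARAMETER `L^kδ_A·|e|`** (v1.1) —
`ineq211At_regularRegion` with the (I.2.34) region input taken in the one-parameter form
`B1Prop23RegularRegionSmall.prop23_regular_region_small` (p35 gen 16; the (I.2.24)/(I.2.25) region inputs of p35 g12 already have this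
form): for `d ≥ 1`, `L ≥ 2`, `a, m² > 0`, `N` and EVERY charge there is a threshold `K₀,min` and, for every `0 ≤ α < 1` and every
`K₀ ≥ K₀,min`, constants `t, δ₁, C > 0` with: for every volume with these `d, L` and `K₀ ∣ M`, every scale `1 ≤ k ≤ K` with `L^kε ≤ 1` and
`3L^kK₀ ≤ |T_ε|_μ`, every big-block union `Ω`, every `A` `δ_A`-regular on `Ω` with the ONE smallness condition `L^kδ_A·|e| ≤ t` — no bound
on `e²` and no `L^kδ_A ≤ c|e|` asked (for the (I.2.23) currency `L^kδ_A ≤ c|e|`, `e² ≤ E₀ := t/(c + 1)` this is `ineq211At_regularRegion`'s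
regime) —: `(regRegionKernelsH _ C Ω A m² a k K₀).Ineq211At α δ₁ C`.  Proof: verbatim that of `ineq211At_regularRegion`, the (I.2.34) block
fed by `prop23_regular_region_small` at `L^lδ_A|e| ≤ L^kδ_A|e| ≤ t`.
[cite: Balaban1983Higgs3, (2.6) p.424, (2.11) p.426] [cite: Balaban1982Higgs1, Prop. 2.1 (2.23)–(2.25) p.610, Prop. 2.3 (2.34) p.611, (2.43) p.612] -/
theorem ineq211At_regularRegion_small (d L : ℕ) (hd : 1 ≤ d) (hL : 2 ≤ L) {a : ℝ} (ha : 0 < a) {msq : ℝ}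
    (hmsq : 0 < msq) (N : ℕ) (C : ChargeData N) :
    ∃ K₀min : ℕ, ∀ {α : ℝ}, 0 ≤ α → α < 1 → ∀ K₀ : ℕ, K₀min ≤ K₀ → ∃ t δ₁ Cst : ℝ, 0 < t ∧ 0 < δ₁ ∧ 0 < Cst ∧
      ∀ (P : HiggsLattice.Params) (hP1 : 1 < P.L), P.d = d → P.L = L → K₀ ∣ P.M →
      ∀ {k : ℕ}, 1 ≤ k → k ≤ P.K → (∀ μ, 3 * half P k K₀ ≤ P.sitesPerDir 0 μ) → P.mesh k ≤ 1 →
      ∀ (Ω : Finset (HiggsLattice.Site P 0)), IsBigBlockUnion k K₀ Ω →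
      ∀ (A : HiggsLattice.VecField P 0) {δA : ℝ}, 0 ≤ δA →
        (∀ z ∈ Ω, ∀ μ ν : Fin P.d, |A ⟨z.shift ν, μ⟩ - A ⟨z, μ⟩| ≤ δA) →
        (P.L : ℝ) ^ k * δA * |C.e| ≤ t →
        (regRegionKernelsH hP1 C Ω A msq a k K₀).Ineq211At α δ₁ Cst := by
  have hL1 : 1 < L := by omega
  obtain ⟨t₃, c₁, ρ₃, ht₃, hc₁, hρ₃, hCov⟩ := B1Prop23RegularRegionSmall.prop23_regular_region_small d L hL1 ha hmsq N
  obtain ⟨K₁, hV⟩ :=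
    B1Ineq225RegularRegion.norm_propagatorK_region_reg_decay_sum d L hd hL ha hmsq N C 1 1 1 zero_le_one one_pos
  obtain ⟨K₄, hHol⟩ :=
    B1Ineq224RegularRegion.norm_holder_propagatorK_region_reg_decay_sum d L hd hL ha hmsq N C 1 1 1 zero_le_one one_pos
  refine ⟨max (max K₁ K₄) 1, fun {α} hα0 hα1 K₀ hK₀ => ?_⟩
  have hK₁ : K₁ ≤ K₀ := ((le_max_left _ _).trans (le_max_left _ _)).trans hK₀
  have hK₄ : K₄ ≤ K₀ := ((le_max_right _ _).trans (le_max_left _ _)).trans hK₀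
  have hK₀1 : 1 ≤ K₀ := (le_max_right _ _).trans hK₀
  obtain ⟨c₀, e₁, hc₀, he₁, hV⟩ := hV K₀ hK₁
  obtain ⟨cH, eH, hcH, heH, hH⟩ := hHol hα0 hα1 K₀ hK₄
  -- the common rate, the smallness threshold and the constant
  obtain ⟨δ, hδ⟩ : ∃ δ : ℝ, δ = min (1 / (4 * (K₀ : ℝ))) ρ₃ := ⟨_, rfl⟩
  have hδpos : 0 < δ := by rw [hδ]; exact lt_min (by positivity) hρ₃
  have hδ₁ : δ ≤ 1 / (4 * K₀) := by rw [hδ]; exact min_le_left _ _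
  have hδ₃ : δ ≤ ρ₃ := by rw [hδ]; exact min_le_right _ _
  have hLpos : (0 : ℝ) < L := by exact_mod_cast (by omega : 0 < L)
  refine ⟨min (min e₁ eH) t₃, δ / (2 * L), cst211 d L N a c₀ cH c₁ δ, lt_min (lt_min he₁ heH) ht₃,
    div_pos hδpos (by positivity), cst211_pos hc₀.le hcH.le hc₁.le, ?_⟩
  intro P hP1 hPd hPL hK₀M k hk1 hkK h3 hmesh Ω hΩ A δA hδA hreg ht
  subst hPd hPL
  have hL1' : 1 < P.L := hP1
  have hLr : 1 < (P.L : ℝ) := by exact_mod_cast hL1'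
  have hLge1 : (1 : ℝ) ≤ P.L := hLr.le
  have hCst : 0 ≤ cst211 P.d P.L N a c₀ cH c₁ δ := (cst211_pos hc₀.le hcH.le hc₁.le).le
  have hte₁ : (P.L : ℝ) ^ k * δA * |C.e| ≤ e₁ := ht.trans ((min_le_left _ _).trans (min_le_left _ _))
  have hteH : (P.L : ℝ) ^ k * δA * |C.e| ≤ eH := ht.trans ((min_le_left _ _).trans (min_le_right _ _))
  have hte₃ : (P.L : ℝ) ^ k * δA * |C.e| ≤ t₃ := ht.trans (min_le_right _ _)
  -- block-union facts at every level `l ≤ k`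
  have hΩl : ∀ {l : ℕ}, l ≤ k → ∀ x x' : HiggsLattice.Site P 0, blockIter l x = blockIter l x' → (x ∈ Ω ↔ x' ∈ Ω) :=
    fun hl => blockUnion_of_isBigBlockUnion hl hΩ
  -- (I.2.25) value at level `l`, engine form, at interior points
  have hGl : ∀ {l : ℕ}, 1 ≤ l → l ≤ k → ∀ (g : ScalarField P 0 N) (M D : ℝ), (∀ x, ‖g x‖ ≤ M) → 0 ≤ D →
      ∀ x, Interior k K₀ Ω x → (∀ z, g z ≠ 0 → D ≤ (HiggsLattice.Site.tdist x z : ℝ)) →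
        ‖propagatorK C Ω A msq a l g x‖ ≤ c₀ * P.mesh l ^ 2 * Real.exp (-(δ * (D / (P.L : ℝ) ^ l))) * M := by
    intro l hl1 hlk g M D hg hD0 x hx hsupp
    have hmesh_l : P.mesh l ≤ 1 := (mesh_mono P hlk).trans hmesh
    have h3l : ∀ μ, 3 * half P l K₀ ≤ P.sitesPerDir 0 μ := fun μ => (Nat.mul_le_mul_left _ (half_mono hlk)).trans (h3 μ)
    have hak : 0 ≤ B1.aSeq a P.L l := (B1.aSeq_pos ha hLr hl1).le
    have h := hV P rfl rfl hK₀M hl1 (hlk.trans hkK) h3l hmesh_l Ω (isBigBlockUnion_of_le hlk hΩ) A he₁ le_rfl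
      (reg223R_of_small C Ω A hlk hmesh_l he₁ hδA hreg hte₁ le_rfl) x (hx.margin hlk) g M D hg hD0 hsupp
    rw [← propagatorK_apply_eq_chi C A hmsq hak (hΩl hlk) g hx.mem] at h
    refine h.trans ?_
    have hM : 0 ≤ M := (norm_nonneg _).trans (hg x)
    have hLl : (0 : ℝ) < (P.L : ℝ) ^ l := pow_pos (by exact_mod_cast P.hL) l
    have hexp := exp_p35_le (P := P) (by omega : 0 < K₀) hδ₁ hD0 hLl
    exact mul_le_mul_of_nonneg_right (mul_le_mul_of_nonneg_left hexp (by positivity)) hM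
  -- (I.2.24) Hölder at level `l`, engine form, at interior row points
  have hHl : ∀ {l : ℕ}, 1 ≤ l → l ≤ k → ∀ (g : ScalarField P 0 N) (M D : ℝ), (∀ x, ‖g x‖ ≤ M) → 0 ≤ D →
      ∀ (μ : Fin P.d) (x x' : HiggsLattice.Site P 0), x' ≠ x → Interior k K₀ Ω x → Interior k K₀ Ω x' →
        ∀ Γ : List (HiggsLattice.Site P 0), IsTChain x Γ →
        pathEnd x Γ = x' → (Γ.length : ℝ) ≤ (P.d : ℝ) * HiggsLattice.Site.tdist x x' →
        (∀ z, g z ≠ 0 → D ≤ (HiggsLattice.Site.tdist x z : ℝ)) → (∀ z, g z ≠ 0 → D ≤ (HiggsLattice.Site.tdist x' z : ℝ)) →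
          (((HiggsLattice.Site.tdist x x' : ℝ) / (P.L : ℝ) ^ l)⁻¹) ^ α *
              ‖hol C A x Γ (covDeriv C A (propagatorK C Ω A msq a l g) ⟨x', μ⟩)
                - covDeriv C A (propagatorK C Ω A msq a l g) ⟨x, μ⟩‖
            ≤ cH * P.mesh l * Real.exp (-(δ * (D / (P.L : ℝ) ^ l))) * M := by
    intro l hl1 hlk g M D hg hD0 μ x x' hne hx hx' Γ hch hend hlen hDx hDx'
    have hmesh_l : P.mesh l ≤ 1 := (mesh_mono P hlk).trans hmesh
    have h3l : ∀ μ, 3 * half P l K₀ ≤ P.sitesPerDir 0 μ := fun μ => (Nat.mul_le_mul_left _ (half_mono hlk)).trans (h3 μ)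
    have hak : 0 ≤ B1.aSeq a P.L l := (B1.aSeq_pos ha hLr hl1).le
    have h := hH P rfl rfl hK₀M hl1 (hlk.trans hkK) h3l hmesh_l Ω (isBigBlockUnion_of_le hlk hΩ) A heH le_rfl
      (reg223R_of_small C Ω A hlk hmesh_l heH hδA hreg hteH le_rfl) μ x x' hne (hx.margin' hlk) (hx'.margin' hlk) Γ hch hend hlen
      g M D hg hD0 hDx hDx'
    -- `D^ε_A(G(1_Ωg))` and `D^ε_A(Gg)` agree at bonds starting at interior points
    have hcut : ∀ y ∈ Ω, propagatorK C Ω A msq a l (chi Ω • g) y = propagatorK C Ω A msq a l g y :=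
      fun y hy => (propagatorK_apply_eq_chi C A hmsq hak (hΩl hlk) g hy).symm
    have hD' : ∀ {y : HiggsLattice.Site P 0}, Interior k K₀ Ω y →
        covDeriv C A (propagatorK C Ω A msq a l (chi Ω • g)) ⟨y, μ⟩ = covDeriv C A (propagatorK C Ω A msq a l g) ⟨y, μ⟩ :=
      fun {y} hy => covDeriv_congr_bond C A (hcut _ hy.mem) (hcut _ (hy.shift_mem μ))
    rw [hD' hx, hD' hx'] at h
    refine h.trans ?_
    have hM : 0 ≤ M := (norm_nonneg _).trans (hg x)
    have hml : 0 < P.mesh l := P.mesh_pos l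
    have hLl : (0 : ℝ) < (P.L : ℝ) ^ l := pow_pos (by exact_mod_cast P.hL) l
    have hexp := exp_p35_le (P := P) (by omega : 0 < K₀) hδ₁ hD0 hLl
    exact mul_le_mul_of_nonneg_right (mul_le_mul_of_nonneg_left hexp (by positivity)) hM
  -- (I.2.34) at level `l < k` on `Ω^{(l)} × Ω^{(l)}`, ONE smallness parameter (p35 g16's `prop23_regular_region_small`)
  have hCl : ∀ {l : ℕ}, 1 ≤ l → l < k → ∀ s t : HiggsLattice.Site P l × Ix N, s.1 ∈ levelSet l Ω → t.1 ∈ levelSet l Ω →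
      |mat (fluctCovA C Ω A msq a l) s t| ≤ c₁ * P.mesh l ^ 2 * Real.exp (-(δ * (HiggsLattice.Site.tdist s.1 t.1 : ℝ))) := by
    intro l hl1 hlk s t hs ht'
    obtain ⟨j, rfl⟩ : ∃ j, l = j + 1 := ⟨l - 1, by omega⟩
    have hmesh_l : P.mesh (j + 1) ≤ 1 := (mesh_mono P hlk.le).trans hmesh
    have hjK : j + 1 < P.K := lt_of_lt_of_le hlk hkK
    have htl : (P.L : ℝ) ^ (j + 1) * δA * |C.e| ≤ t₃ := by
      have hpow : (P.L : ℝ) ^ (j + 1) ≤ (P.L : ℝ) ^ k := pow_le_pow_right₀ hLge1 hlk.le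
      exact (mul_le_mul_of_nonneg_right (mul_le_mul_of_nonneg_right hpow hδA) (abs_nonneg _)).trans hte₃
    have hjk : j < k := by omega
    have hpf : B2Eq328ConcretePieces.pieceF (towerR Ω k) ⟨j, hjk⟩ = Ω := pieceF_towerR ⟨j, hjk⟩ (hΩl hlk.le)
    have hregF : ∀ z ∈ B2Eq328ConcretePieces.pieceF (towerR Ω k) ⟨j, hjk⟩, ∀ μ' ν : Fin P.d,
        |A ⟨z.shift ν, μ'⟩ - A ⟨z, μ'⟩| ≤ δA := by
      rw [hpf]; exact hreg
    have hj2 : j + 2 ≤ k := by omega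
    have hΛ := levelSet_blockUnion hjK.le (hΩl hlk.le) (hΩl hj2)
    have h := (hCov C P rfl rfl (towerR Ω k) hkK ⟨j, hjk⟩ hjK hmesh_l hΛ A hδA hregF htl (Λ := levelSet (j + 1) Ω)
      (subset_refl _) hs ht').1
    rw [hpf, mat_condCov232_levelSet C A hjK.le hmsq ha hLr (hΩl hlk.le) (hΩl hj2) hs] at h
    refine h.trans ?_
    have hexp : Real.exp (-(ρ₃ * (HiggsLattice.Site.tdist s.1 t.1 : ℝ))) ≤
        Real.exp (-(δ * (HiggsLattice.Site.tdist s.1 t.1 : ℝ))) :=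
      exp_le_exp_of_le (mul_le_mul_of_nonneg_right hδ₃ (Nat.cast_nonneg _))
    calc P.mesh (j + 1) ^ 2 * c₁ * Real.exp (-(ρ₃ * (HiggsLattice.Site.tdist s.1 t.1 : ℝ)))
        ≤ P.mesh (j + 1) ^ 2 * c₁ * Real.exp (-(δ * (HiggsLattice.Site.tdist s.1 t.1 : ℝ))) :=
          mul_le_mul_of_nonneg_left hexp (by positivity)
      _ = _ := by ring
  -- rate bookkeeping: `δ/(2L) ≤ δ/2` and the `j = 0` exponent (rate `δ` at level `1` beats rate `δ/(2L)` at level `0`)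
  have hrate : δ / (2 * P.L) ≤ δ / 2 := by
    rw [div_le_div_iff₀ (by positivity) (by norm_num : (0 : ℝ) < 2)]
    nlinarith
  have hexp0 : ∀ m : ℝ, 0 ≤ m →
      Real.exp (-(δ * (m / (P.L : ℝ) ^ 1))) ≤ Real.exp (-(δ / (2 * P.L) * (m / (P.L : ℝ) ^ 0))) := by
    intro m hm
    apply exp_le_exp_of_le
    rw [pow_one, pow_zero, div_one]
    have h0 : 0 ≤ δ * (m / P.L) := by positivity
    calc δ / (2 * P.L) * m = (1 / 2) * (δ * (m / P.L)) := by ring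
      _ ≤ δ * (m / P.L) := by linarith
  have hexpj : ∀ (j : ℕ) (m : ℝ), 0 ≤ m →
      Real.exp (-(δ / 2 * (m / (P.L : ℝ) ^ j))) ≤ Real.exp (-(δ / (2 * P.L) * (m / (P.L : ℝ) ^ j))) :=
    fun j m hm => exp_rate_mono hrate (by positivity)
  have hgood : ∀ x, Interior k K₀ Ω x → x ∈ Ω := fun x hx => hx.mem
  have hgood' : ∀ (x : HiggsLattice.Site P 0) (μ : Fin P.d), Interior k K₀ Ω x → x.shift μ ∈ Ω :=
    fun x μ hx => hx.shift_mem μ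
  refine ineq211At_of_boundsR hCst (fun j μ x₁ x₂ x hx₁ hx₂ hx hne Γ hΓ => ?_)
  have hmj : 0 < P.mesh j := P.mesh_pos j
  have hmin : 0 ≤ min (HiggsLattice.Site.tdist x₁ x : ℝ) (HiggsLattice.Site.tdist x₂ x : ℝ) :=
    le_min (Nat.cast_nonneg _) (Nat.cast_nonneg _)
  rcases Nat.eq_zero_or_pos j with rfl | hj1
  · -- the piece `G^η_{(0)} = G^ε_1(Ω,A)`: (I.2.24) at level `1`
    refine (holder_pieceR_zero_le C Ω A msq (k := k) hα0 (hHl le_rfl hk1) μ hne hx₁ hx₂ x hΓ).trans ?_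
    exact mul_le_mul (mul_le_mul_of_nonneg_right (le_cst211_zero hc₀.le hcH.le hc₁.le) (by positivity)) (hexp0 _ hmin)
      (Real.exp_pos _).le (by positivity)
  · by_cases hjk : j < k
    · refine (holder_pieceR_pos_le C Ω A msq ha hL1' hj1 hjk (hjk.le.trans hkK) hmsq (hΩl hjk.le) hgood hgood' hc₀.le hcH.le
        hc₁.le hδpos (hGl hj1 hjk.le) (hHl hj1 hjk.le) (hCl hj1 hjk) μ hne hx₁ hx₂ hx hΓ).trans ?_
      exact mul_le_mul (mul_le_mul_of_nonneg_right (le_cst211_pos hc₀.le hcH.le hc₁.le) (by positivity)) (hexpj j _ hmin)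
        (Real.exp_pos _).le (by positivity)
    · rw [holderTermR_eq_zero_of_le C Ω A msq hj1 (not_lt.mp hjk), mul_zero]
      positivity

/-- **The same, un-subtyped, one smallness parameter** (the form consumers on the full lattice use; cf. `ineq211At_regularRegion_explicit`).
[cite: Balaban1983Higgs3, (2.11) p.426] [cite: Balaban1982Higgs1, Prop. 2.1 p.610] -/
theorem ineq211At_regularRegion_small_explicit (d L : ℕ) (hd : 1 ≤ d) (hL : 2 ≤ L) {a : ℝ} (ha : 0 < a) {msq : ℝ}
    (hmsq : 0 < msq) (N : ℕ) (C : ChargeData N) :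
    ∃ K₀min : ℕ, ∀ {α : ℝ}, 0 ≤ α → α < 1 → ∀ K₀ : ℕ, K₀min ≤ K₀ → ∃ t δ₁ Cst : ℝ, 0 < t ∧ 0 < δ₁ ∧ 0 < Cst ∧
      ∀ (P : HiggsLattice.Params), 1 < P.L → P.d = d → P.L = L → K₀ ∣ P.M →
      ∀ {k : ℕ}, 1 ≤ k → k ≤ P.K → (∀ μ, 3 * half P k K₀ ≤ P.sitesPerDir 0 μ) → P.mesh k ≤ 1 →
      ∀ (Ω : Finset (HiggsLattice.Site P 0)), IsBigBlockUnion k K₀ Ω →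
      ∀ (A : HiggsLattice.VecField P 0) {δA : ℝ}, 0 ≤ δA →
        (∀ z ∈ Ω, ∀ μ ν : Fin P.d, |A ⟨z.shift ν, μ⟩ - A ⟨z, μ⟩| ≤ δA) →
        (P.L : ℝ) ^ k * δA * |C.e| ≤ t →
        ∀ (j : ℕ) (μ : Fin P.d) (x₁ x₂ x : HiggsLattice.Site P 0), Interior k K₀ Ω x₁ → Interior k K₀ Ω x₂ → Interior k K₀ Ω x →
          x₁ ≠ x₂ → ∀ Γ : List (HiggsLattice.Site P 0), IsAdm x₁ x₂ Γ →
          holderTermR C Ω A msq a k j μ x₁ x₂ x Γ / (P.mesh 0 * (HiggsLattice.Site.tdist x₁ x₂ : ℝ)) ^ α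
            ≤ Cst * P.mesh j ^ ((1 : ℝ) - (P.d : ℝ) - α) *
              Real.exp (-(δ₁ * (P.mesh j)⁻¹ *
                (P.mesh 0 * min (HiggsLattice.Site.tdist x₁ x : ℝ) (HiggsLattice.Site.tdist x₂ x : ℝ)))) := by
  obtain ⟨K₀min, h⟩ := ineq211At_regularRegion_small d L hd hL ha hmsq N C
  refine ⟨K₀min, fun {α} hα0 hα1 K₀ hK₀ => ?_⟩
  obtain ⟨t, δ₁, Cst, ht, hδ₁, hCst, h⟩ := h hα0 hα1 K₀ hK₀
  refine ⟨t, δ₁, Cst, ht, hδ₁, hCst, ?_⟩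
  intro P hP1 hPd hPL hK₀M k hk1 hkK h3 hmesh Ω hΩ A δA hδA hreg ht' j μ x₁ x₂ x hx₁ hx₂ hx hne Γ hΓ
  have h' := h P hP1 hPd hPL hK₀M hk1 hkK h3 hmesh Ω hΩ A hδA hreg ht' j μ ⟨x₁, hx₁⟩ ⟨x₂, hx₂⟩ ⟨x, hx⟩
    (fun heq => hne (congrArg Subtype.val heq))
  rw [scaleHR_eq] at h'
  have hdist : 0 ≤ (P.mesh 0 * (HiggsLattice.Site.tdist x₁ x₂ : ℝ)) ^ α :=
    Real.rpow_nonneg (mul_nonneg (P.mesh_pos 0).le (Nat.cast_nonneg _)) _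
  exact le_trans (div_le_div_of_nonneg_right
    (holderTermR_le_holderDiff (hL1 := hP1) (C := C) (Ω := Ω) (A := A) (msq := msq) (a := a) (k := k) (K₀ := K₀) j μ
      ⟨x₁, hx₁⟩ ⟨x₂, hx₂⟩ ⟨x, hx⟩ hΓ) hdist) h'

end SmallHR

/-! ## §6 (2.10) ∧ (2.11) on the SAME region carrier with ONE smallness parameter (v1.2)

v1.2 (p35 gen 17, APPEND-ONLY: every v1.0/v1.1 declaration and locator unchanged, no new import):
**`ineq210_and_211At_regularRegionH_small`** — the conjunction `ineq210_and_211At_regularRegionH` of §4 in the one-parameter regime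
`L^kδ_A·|e| ≤ t` for EVERY charge (no `e² ≤ E₀`, no `L^kδ_A ≤ c|e|`), now that BOTH members exist in that form: r14 g18's region (2.10)
`B3Ineq210RegularRegion.ineq210_regularRegion_small` (v1.2 of that file, p342745) and §5's `ineq211At_regularRegion_small`.  The two
weakening steps of §4 (a smaller rate and a larger constant preserve (2.10), resp. (2.11) at fixed `α`) are recorded once, for any
carrier of `ScaledKernels` with positive scales and non-negative distances (`ineq210_weaken`, `ineq211At_weaken`), and instantiated on
`regRegionKernelsH` (`scaleHR_pos`, `distHR_nonneg`, `dist2HR_nonneg`).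

statement-level skeleton of published theorems with citation tags; proofs where landed; nothing here is a claim about the Yang–Mills mass gap -/

section WeakenHR

/-- **Weakening of the constants in (2.10).**  For any carrier of the (2.10)–(2.12) kernels with positive length scales `L^jη` and a
non-negative distance, a smaller rate `δ₁′ ≤ δ₁` and a larger constant `C ≤ C′` (`0 ≤ C`) preserve the display (2.10) together with its
differentiated form. [cite: Balaban1983Higgs3, (2.10) p.426] -/
theorem ineq210_weaken (S : ScaledKernels) {δ₁ δ₁' Cst Cst' : ℝ} (hδ : δ₁' ≤ δ₁) (hC : Cst ≤ Cst') (hC0 : 0 ≤ Cst)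
    (hs : ∀ j, 0 < S.scale j) (hdist : ∀ x x', 0 ≤ S.dist x x') (h : S.Ineq210 δ₁ Cst) : S.Ineq210 δ₁' Cst' := by
  intro j x x'
  obtain ⟨hv, hd'⟩ := h j x x'
  have hexp : Real.exp (-(δ₁ * (S.scale j)⁻¹ * S.dist x x')) ≤ Real.exp (-(δ₁' * (S.scale j)⁻¹ * S.dist x x')) := by
    rw [mul_assoc, mul_assoc]
    exact exp_rate_mono hδ (mul_nonneg (inv_nonneg.mpr (hs j).le) (hdist x x'))
  refine ⟨hv.trans ?_, fun μ => (hd' μ).trans ?_⟩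
  · exact mul_le_mul (mul_le_mul_of_nonneg_right hC (Real.rpow_nonneg (hs j).le _)) hexp
      (Real.exp_pos _).le (mul_nonneg (hC0.trans hC) (Real.rpow_nonneg (hs j).le _))
  · exact mul_le_mul (mul_le_mul_of_nonneg_right hC (Real.rpow_nonneg (hs j).le _)) hexp
      (Real.exp_pos _).le (mul_nonneg (hC0.trans hC) (Real.rpow_nonneg (hs j).le _))

/-- **Weakening of the constants in (2.11) at a fixed exponent.**  For any carrier with positive length scales and a non-negative
`dist({x₁,x₂},x)`, a smaller rate `δ₁′ ≤ δ₁` and a larger constant `C ≤ C′` (`0 ≤ C`) preserve the display (2.11) at `α`.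
[cite: Balaban1983Higgs3, (2.11) p.426] -/
theorem ineq211At_weaken (S : ScaledKernels) {α δ₁ δ₁' Cst Cst' : ℝ} (hδ : δ₁' ≤ δ₁) (hC : Cst ≤ Cst') (hC0 : 0 ≤ Cst)
    (hs : ∀ j, 0 < S.scale j) (hdist2 : ∀ x₁ x₂ x, 0 ≤ S.dist2 x₁ x₂ x) (h : S.Ineq211At α δ₁ Cst) :
    S.Ineq211At α δ₁' Cst' := by
  intro j μ x₁ x₂ x hne
  have hexp : Real.exp (-(δ₁ * (S.scale j)⁻¹ * S.dist2 x₁ x₂ x)) ≤ Real.exp (-(δ₁' * (S.scale j)⁻¹ * S.dist2 x₁ x₂ x)) := by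
    rw [mul_assoc, mul_assoc]
    exact exp_rate_mono hδ (mul_nonneg (inv_nonneg.mpr (hs j).le) (hdist2 x₁ x₂ x))
  refine (h j μ x₁ x₂ x hne).trans ?_
  exact mul_le_mul (mul_le_mul_of_nonneg_right hC (Real.rpow_nonneg (hs j).le _)) hexp
    (Real.exp_pos _).le (mul_nonneg (hC0.trans hC) (Real.rpow_nonneg (hs j).le _))

variable {hL1 : 1 < P.L} {C : ChargeData N} {Ω : Finset (HiggsLattice.Site P 0)} {A : HiggsLattice.VecField P 0} {msq a : ℝ}
  {k K₀ : ℕ}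

/-- The length scales `L^jε` of the region carrier are positive. [cite: Balaban1983Higgs3, (2.10) p.426] -/
theorem scaleHR_pos (j : ℕ) : 0 < (regRegionKernelsH hL1 C Ω A msq a k K₀).scale j := by
  rw [scaleHR_eq]; exact P.mesh_pos j

/-- The distance `ε|x − x′|` of the region carrier is non-negative. [cite: Balaban1983Higgs3, (2.10) p.426] -/
theorem distHR_nonneg (x x' : {x : HiggsLattice.Site P 0 // Interior k K₀ Ω x}) :
    0 ≤ (regRegionKernelsH hL1 C Ω A msq a k K₀).dist x x' := by
  show 0 ≤ P.mesh 0 * (HiggsLattice.Site.tdist x.1 x'.1 : ℝ)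
  exact mul_nonneg (P.mesh_pos 0).le (Nat.cast_nonneg _)

/-- The distance `dist({x₁,x₂},x) = ε·min(|x₁ − x|, |x₂ − x|)` of the region carrier is non-negative.
[cite: Balaban1983Higgs3, (2.11) p.426] -/
theorem dist2HR_nonneg (x₁ x₂ x : {x : HiggsLattice.Site P 0 // Interior k K₀ Ω x}) :
    0 ≤ (regRegionKernelsH hL1 C Ω A msq a k K₀).dist2 x₁ x₂ x := by
  show 0 ≤ P.mesh 0 * min (HiggsLattice.Site.tdist x₁.1 x.1 : ℝ) (HiggsLattice.Site.tdist x₂.1 x.1 : ℝ)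
  exact mul_nonneg (P.mesh_pos 0).le (le_min (Nat.cast_nonneg _) (Nat.cast_nonneg _))

end WeakenHR

section SmallJointHR

/-- **(2.10) and (2.11) on the SAME region carrier, ONE smallness parameter** (v1.2).  For `d ≥ 1`, `L ≥ 2`, `a, m² > 0`, `N` and
EVERY charge there is a threshold `K₀,min` and, for every `0 ≤ α < 1` and every `K₀ ≥ K₀,min`, constants `t, δ₁, C > 0` with: for
every volume with these `d, L` and `K₀ ∣ M`, every scale `1 ≤ k ≤ K` with `L^kε ≤ 1` and `3L^kK₀ ≤ |T_ε|_μ`, every big-block union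
`Ω ⊂ T_ε`, every `A` `δ_A`-regular on `Ω` with the SINGLE smallness condition `L^kδ_A·|e| ≤ t` (print's *"for e(L^kε) sufficiently
small"* of Proposition I.2.1, in the (I.2.23) currency; no `e² ≤ E₀`, no `L^kδ_A ≤ c|e|`): the carrier `regRegionKernelsH _ C Ω A m² a k K₀`
satisfies r14's region (2.10) (`Ineq210 δ₁ C`, through `ineq210_iff_HR` from `B3Ineq210RegularRegion.ineq210_regularRegion_small`) AND
(2.11) at `α` (`Ineq211At α δ₁ C`, §5's `ineq211At_regularRegion_small`) with the SAME `(δ₁, C)` — the two members' thresholds are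
joined (`K₀,min = max`, `t = min`) and their constants weakened to a common pair (`δ₁ = min`, `C = max`; `ineq210_weaken`,
`ineq211At_weaken`).  Scope = that of the two members (interior points only — all three of `x₁, x₂, x`; `m² > 0`; big-block unions with
the cube-count hypothesis and `K₀ ∣ M`; no parity condition on `L`; constants depend on `α`, on `K₀` and, through the (I.2.24)/(I.2.25)
thresholds, on the charge data — GAPS G-B3-11).
[cite: Balaban1983Higgs3, (2.6) p.424, (2.10)–(2.11) p.426] [cite: Balaban1982Higgs1, Prop. 2.1 (2.23)–(2.25) p.610, Prop. 2.3 (2.34) p.611, (2.43) p.612] -/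
theorem ineq210_and_211At_regularRegionH_small (d L : ℕ) (hd : 1 ≤ d) (hL : 2 ≤ L) {a : ℝ} (ha : 0 < a) {msq : ℝ}
    (hmsq : 0 < msq) (N : ℕ) (C : ChargeData N) :
    ∃ K₀min : ℕ, ∀ {α : ℝ}, 0 ≤ α → α < 1 → ∀ K₀ : ℕ, K₀min ≤ K₀ → ∃ t δ₁ Cst : ℝ, 0 < t ∧ 0 < δ₁ ∧ 0 < Cst ∧
      ∀ (P : HiggsLattice.Params) (hP1 : 1 < P.L), P.d = d → P.L = L → K₀ ∣ P.M →
      ∀ {k : ℕ}, 1 ≤ k → k ≤ P.K → (∀ μ, 3 * half P k K₀ ≤ P.sitesPerDir 0 μ) → P.mesh k ≤ 1 →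
      ∀ (Ω : Finset (HiggsLattice.Site P 0)), IsBigBlockUnion k K₀ Ω →
      ∀ (A : HiggsLattice.VecField P 0) {δA : ℝ}, 0 ≤ δA →
        (∀ z ∈ Ω, ∀ μ ν : Fin P.d, |A ⟨z.shift ν, μ⟩ - A ⟨z, μ⟩| ≤ δA) →
        (P.L : ℝ) ^ k * δA * |C.e| ≤ t →
        (regRegionKernelsH hP1 C Ω A msq a k K₀).Ineq210 δ₁ Cst ∧
          (regRegionKernelsH hP1 C Ω A msq a k K₀).Ineq211At α δ₁ Cst := by
  obtain ⟨K₁, h₁⟩ := B3Ineq210RegularRegion.ineq210_regularRegion_small d L hd hL ha hmsq N C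
  obtain ⟨K₂, h₂⟩ := ineq211At_regularRegion_small d L hd hL ha hmsq N C
  refine ⟨max K₁ K₂, fun {α} hα0 hα1 K₀ hK₀ => ?_⟩
  obtain ⟨t₁, δ₁, C₁, ht₁, hδ₁, hC₁, h₁⟩ := h₁ K₀ ((le_max_left _ _).trans hK₀)
  obtain ⟨t₂, δ₂, C₂, ht₂, hδ₂, hC₂, h₂⟩ := h₂ hα0 hα1 K₀ ((le_max_right _ _).trans hK₀)
  refine ⟨min t₁ t₂, min δ₁ δ₂, max C₁ C₂, lt_min ht₁ ht₂, lt_min hδ₁ hδ₂, lt_max_of_lt_left hC₁, ?_⟩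
  intro P hP1 hPd hPL hK₀M k hk1 hkK h3 hmesh Ω hΩ A δA hδA hreg ht
  have hA := h₁ P hP1 hPd hPL hK₀M hk1 hkK h3 hmesh Ω hΩ A hδA hreg (ht.trans (min_le_left _ _))
  have hB := h₂ P hP1 hPd hPL hK₀M hk1 hkK h3 hmesh Ω hΩ A hδA hreg (ht.trans (min_le_right _ _))
  refine ⟨?_, ?_⟩
  · exact ineq210_weaken (regRegionKernelsH hP1 C Ω A msq a k K₀) (min_le_left _ _) (le_max_left _ _) hC₁.le
      scaleHR_pos distHR_nonneg ((ineq210_iff_HR δ₁ C₁).mpr hA)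
  · exact ineq211At_weaken (regRegionKernelsH hP1 C Ω A msq a k K₀) (min_le_right _ _) (le_max_right _ _) hC₂.le
      scaleHR_pos dist2HR_nonneg hB

end SmallJointHR

end Literature.MathematicalPhysics.QuantumFieldTheory.Balaban1983to89.B3Ineq211RegularRegion

end
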